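import Literature.Computability.Cryptography.HILLGreedyHybrid
import Literature.Computability.Cryptography.HILLEntropy
import Literature.Computability.Cryptography.HILLExtractSmooth
import Literature.Computability.Cryptography.IndistinguishabilityAdvicePostProcessing
import Literature.Computability.Cryptography.IndistinguishabilityAdviceAppend
import Literature.Computability.Cryptography.MildlyNonuniformPRG
import HarnessLib

/-!
# HILL's direct construction of a (mildly non-uniform) pseudorandom generator (Håstad–Impagliazzo–Levin–Luby 1999, §7)

> **Construction 7.0.4** `g(X', Y', R₁, R₂, R₃) = ⟨h_{R₁}(X'), h_{R₂}(b^{kₙ}(X', Y')), h_{R₃}(f'^{kₙ}(X')), Y', R₁, R₂, R₃⟩`,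
> `mₙ = kₙ(cₙ − eₙ − pₙ + 1/2n) − 2nkₙ^{2/3}`, `m'ₙ = kₙpₙ − 2nkₙ^{2/3}`, `m''ₙ = kₙeₙ − 2nkₙ^{2/3}`.
> **Theorem 7.0.5** If `f` is a one-way function [and `ẽₙ`, `p̃ₙ` are within `1/n` of `eₙ`, `pₙ`] then `g` is a
> mildly non-uniform pseudorandom generator. *Proof*: (1) replacing `h_{R₁}(X')` by random bits gives a
> distribution `1/n`-statistically close (Cor. 4.5.3, conditional entropy of `X` given `f'(X)` and `b(X,Y)`
> is at least `cₙ − eₙ − pₙ + 1/2n`); (2) `h_{R₂}(b^{kₙ})` is computationally indistinguishable from random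
> bits given the rest (Lemmas 6.3.2 and 6.1.1); (3) replacing `h_{R₃}(f'^{kₙ}(X'))` by random bits is again
> statistically close (Cor. 4.5.3). [HILL 1999, §7, p. 38–39]

This file: the level-`N` generator core in the tree's vocabulary — per position the coins are
`pc = w ‖ ρ ‖ σ ‖ u` (`HILLGreedySamplers`), `f'(w, ρ) = g f (w ‖ ρ)` (`HILLHashedFunction`), the `K = ⌊log₂N⌋`
Goldreich–Levin bits `glBits K N w σ` replace the single bit `b`; the three hashes are the affine family
`hashStr`; the hybrids `X0 … X3` of the proof of Thm 7.0.5; the per-copy conditional entropy bound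
(`HILLEntropy`) and the two statistical steps via `extract_cond_test_smooth`; the computational step from
`isCompIndistinguishable_DE` by appending fresh coins and post-processing with advice
(`IsCompIndistinguishable.map_fp_advice`). No new named facts.
-/

namespace Literature.Computability.Cryptography

open Finset Filter _root_.Computability Complexity Polynomial Real AffineStr HCProd PRGTrunc

namespace HILL

namespace GH

namespace Params

variable (P : Params) (f : List Bool → List Bool)

/-! ### Lengths and the per-position maps -/

/-- `|pcs| = k·cP`. [folklore] -/
def Lp (N : ℕ) : ℕ := P.kk N * cP N

/-- `|F'| = k·Lg`. [folklore] -/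
def fLen (N : ℕ) : ℕ := P.kk N * Lg N

/-- `|Y'| = k·K·N`. [folklore] -/
def yLen (N : ℕ) : ℕ := P.kk N * (kL N * N)

/-- `F' = (f'(w_j, ρ_j))_j` read off the position coins. [cite: HastadImpagliazzoLevinLuby1999, §6.2 eq. (8) (f'^{kₙ}(X'))] -/
noncomputable def fprimes (N : ℕ) (pcs : List Bool) : List Bool :=
  ((List.range (P.kk N)).map fun i => g f (pcW N (Greedy.blkL (cP N) i pcs) ++ pcR N (Greedy.blkL (cP N) i pcs))).flatten

/-- `Y' = (σ_j)_j`. [cite: HastadImpagliazzoLevinLuby1999, §6.2 eq. (8) (Y')] -/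
def yprimes (N : ℕ) (pcs : List Bool) : List Bool :=
  ((List.range (P.kk N)).map fun i => pcS N (Greedy.blkL (cP N) i pcs)).flatten

/-- `F'` read off the public parts `pubs = (f'_j ‖ σ_j)_j`. [folklore] -/
def fOfPubs (N : ℕ) (pubs : List Bool) : List Bool :=
  ((List.range (P.kk N)).map fun i => (Greedy.blkL (pubLen N) i pubs).take (Lg N)).flatten

/-- `Y'` read off the public parts. [folklore] -/
def yOfPubs (N : ℕ) (pubs : List Bool) : List Bool :=
  ((List.range (P.kk N)).map fun i => (Greedy.blkL (pubLen N) i pubs).drop (Lg N)).flatten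

variable {P f}

/-- Lengths of the position slices. [folklore] -/
theorem length_pcW {N : ℕ} {pc : List Bool} (hpc : pc.length = cP N) : (pcW N pc).length = N := by
  rw [pcW, List.length_take, hpc, cP]; omega

/-- Length of a position slice. [folklore] -/
theorem length_pcR {N : ℕ} {pc : List Bool} (hpc : pc.length = cP N) : (pcR N pc).length = rlen N := by
  rw [pcR, List.length_take, List.length_drop, hpc, cP]; omega

/-- Length of a position slice. [folklore] -/
theorem length_pcS {N : ℕ} {pc : List Bool} (hpc : pc.length = cP N) : (pcS N pc).length = kL N * N := by
  rw [pcS, List.length_take, List.length_drop, hpc, cP]; omega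

/-- Length of a position slice. [folklore] -/
theorem length_pcU {N : ℕ} {pc : List Bool} (hpc : pc.length = cP N) : (pcU N pc).length = kL N := by
  rw [pcU, List.length_take, List.length_drop, hpc, cP]; omega

/-- The four slices reassemble the position coins. [folklore] -/
theorem pc_eq_append {N : ℕ} {pc : List Bool} (hpc : pc.length = cP N) : pc = pcW N pc ++ pcR N pc ++ pcS N pc ++ pcU N pc := by
  have h4 : pcU N pc = pc.drop (N + rlen N + kL N * N) :=
    List.take_of_length_le (by rw [List.length_drop, hpc, cP]; omega)
  have d2 : (pc.drop N).drop (rlen N) = pc.drop (N + rlen N) := by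
    rw [List.drop_drop]
  have d3 : (pc.drop (N + rlen N)).drop (kL N * N) = pc.drop (N + rlen N + kL N * N) := by
    rw [List.drop_drop]
  rw [pcW, pcR, pcS, h4]
  conv_lhs => rw [← List.take_append_drop N pc, ← List.take_append_drop (rlen N) (pc.drop N), d2,
    ← List.take_append_drop (kL N * N) (pc.drop (N + rlen N)), d3]
  simp only [List.append_assoc]

/-- `|f'(w,ρ)| = Lg N`. [folklore] -/
theorem length_gpos (hlp : IsLengthPreserving f) {N : ℕ} {pc : List Bool} (hpc : pc.length = cP N) :
    (g f (pcW N pc ++ pcR N pc)).length = Lg N := length_g hlp (length_pcW hpc) (length_pcR hpc)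

/-- `|F'| = fLen`. [folklore] -/
theorem length_fprimes (hlp : IsLengthPreserving f) {N : ℕ} {pcs : List Bool} (hpcs : pcs.length = P.Lp N) : (P.fprimes f N pcs).length = P.fLen N :=
  length_flatten_map_range fun _ hi => length_gpos hlp (length_blkL hpcs hi)

/-- `|Y'| = yLen`. [folklore] -/
theorem length_yprimes {N : ℕ} {pcs : List Bool} (hpcs : pcs.length = P.Lp N) : (P.yprimes N pcs).length = P.yLen N :=
  length_flatten_map_range fun _ hi => length_pcS (length_blkL hpcs hi)

/-- The public part of position `i` for the empty template. [folklore] -/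
theorem posPub_nil (N i : ℕ) (pc : List Bool) : posPub f N [] false [] i pc = g f (pcW N pc ++ pcR N pc) ++ pcS N pc := by
  simp [posPub]

/-- The block of position `i` for the empty template. [folklore] -/
theorem posBlk_nil (N i : ℕ) (pc : List Bool) : posBlk N [] false [] i pc = glBits (kL N) N (pcW N pc) (pcS N pc) := by
  simp [posBlk]

/-- Block `i` of `pubs` (empty template). [folklore] -/
theorem blkL_pubs (hlp : IsLengthPreserving f) {N : ℕ} {pcs : List Bool} (hpcs : pcs.length = P.Lp N) {i : ℕ} (hi : i < P.kk N) :
    Greedy.blkL (pubLen N) i (P.pubs f N [] false [] pcs) = g f (pcW N (Greedy.blkL (cP N) i pcs) ++ pcR N (Greedy.blkL (cP N) i pcs)) ++ pcS N (Greedy.blkL (cP N) i pcs) := by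
  rw [pubs, blkL_flatten (fun j hj => length_posPub hlp (τ := []) (by simp) (fun h => absurd h Bool.false_ne_true) j (length_blkL hpcs hj)) hi,
    posPub_nil]

/-- **`F'(pubs) = F'`.** [folklore] -/
theorem fOfPubs_pubs (hlp : IsLengthPreserving f) {N : ℕ} {pcs : List Bool} (hpcs : pcs.length = P.Lp N) :
    P.fOfPubs N (P.pubs f N [] false [] pcs) = P.fprimes f N pcs := by
  unfold fOfPubs fprimes
  congr 1
  refine List.map_congr_left fun i hi => ?_
  rw [List.mem_range] at hi
  rw [blkL_pubs hlp hpcs hi, List.take_append_of_le_length (length_gpos hlp (length_blkL hpcs hi)).ge,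
    List.take_of_length_le (length_gpos hlp (length_blkL hpcs hi)).le]

/-- **`Y'(pubs) = Y'`.** [folklore] -/
theorem yOfPubs_pubs (hlp : IsLengthPreserving f) {N : ℕ} {pcs : List Bool} (hpcs : pcs.length = P.Lp N) :
    P.yOfPubs N (P.pubs f N [] false [] pcs) = P.yprimes N pcs := by
  unfold yOfPubs yprimes
  congr 1
  refine List.map_congr_left fun i hi => ?_
  rw [List.mem_range] at hi
  rw [blkL_pubs hlp hpcs hi, List.drop_append_of_le_length (length_gpos hlp (length_blkL hpcs hi)).ge,
    List.drop_of_length_le (length_gpos hlp (length_blkL hpcs hi)).le, List.nil_append]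

variable (P f)

/-! ### The advice `a = t·EB(N) + e` and the hash lengths -/

/-- Range of the entropy index `e` (`ẽ = e·K/2^{b+2} ≤ Lg N` needs `e ≤ 4·Lg·2^b`). [cite: HastadImpagliazzoLevinLuby1999, §7 ("there are O(n³) possible pairs")] -/
def EB (N : ℕ) : ℕ := 8 * (Lg N + 1) * 2 ^ bLen N

/-- The density part `t` of the advice. [folklore] -/
def tOfA (N a : ℕ) : ℕ := a / EB N

/-- The entropy part `e` of the advice. [folklore] -/
def eOfA (N a : ℕ) : ℕ := a % EB N

/-- `k/(16·2^b)`: the flattening slack `kη·cP` with `η = 1/(16 cP 2^b)`. [cite: HastadImpagliazzoLevinLuby1999, §7 ("sacrifice 2nk^{2/3}")] -/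
def slack (N : ℕ) : ℕ := P.kk N / (16 * 2 ^ bLen N)

/-- `m₂ = m'ₙ`: the output length of `h₂` (the `mlen` of the samplers at the density advice). [cite: HastadImpagliazzoLevinLuby1999, Constr. 7.0.4 (m'ₙ)] -/
def m2 (N a : ℕ) : ℕ := P.mlen N (tOfA N a)

/-- `m₃ = m''ₙ ≈ kẽ − kη cP − 2N − 2`. [cite: HastadImpagliazzoLevinLuby1999, Constr. 7.0.4 (m''ₙ = kₙẽₙ − 2nkₙ^{2/3})] -/
def m3 (N a : ℕ) : ℕ := P.kk N * eOfA N a * kL N / 2 ^ (bLen N + 2) - P.slack N - (2 * N + 2)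

/-- `m₁ + m₃` (free of the entropy advice): `k(c − K t/2^b + K/2^{b+1}) − 2·slack − 2(2N+2) − 3`, `c = N + rlen + K`.
[cite: HastadImpagliazzoLevinLuby1999, Constr. 7.0.4 (mₙ + m''ₙ)] -/
def M13 (N a : ℕ) : ℕ :=
  P.kk N * (N + rlen N + kL N) + P.kk N * kL N / 2 ^ (bLen N + 1) - P.kk N * kL N * tOfA N a / 2 ^ bLen N - 2 * P.slack N - 2 * (2 * N + 2) - 3

/-- `m₁ = mₙ ≈ k(c − ẽ − K p̃ + Kq/2) − kη cP − 2N − 5`. [cite: HastadImpagliazzoLevinLuby1999, Constr. 7.0.4 (mₙ)] -/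
def m1 (N a : ℕ) : ℕ := P.M13 N a - P.m3 N a

/-- The key of `h₁`: `m₁(|pcs| + 1)` bits. [cite: HastadImpagliazzoLevinLuby1999, §4.4 (description of h)] -/
def key1 (N a : ℕ) : ℕ := P.m1 N a * (P.Lp N + 1)

/-- The key of `h₃`: `m₃(|F'| + 1)` bits. [cite: HastadImpagliazzoLevinLuby1999, §4.4 (description of h)] -/
def key3 (N a : ℕ) : ℕ := P.m3 N a * (P.fLen N + 1)

/-- `|R| = m₁ + |U₁| + |U₃|`: the fresh part appended in the hybrids. [folklore] -/
def rLen (N a : ℕ) : ℕ := P.m1 N a + P.key1 N a + P.key3 N a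

/-- The core seed length `|pcs| + |U| + |U₁| + |U₃|`. [folklore] -/
def coreLen (N a : ℕ) : ℕ := P.Lp N + P.uLen N (tOfA N a) + P.key1 N a + P.key3 N a

/-- The core output length. [folklore] -/
def outLen (N a : ℕ) : ℕ := P.key3 N a + P.yLen N + P.m3 N a + P.uLen N (tOfA N a) + P.m2 N a + P.m1 N a + P.key1 N a

/-! ### The generator core and the simulator `Φ` -/

/-- **The output layout** `U₃ ‖ Y' ‖ h₃ ‖ U ‖ v₂ ‖ h₁ ‖ U₁` (a permutation of HILL's `⟨h₁, h₂, h₃, Y', R₁, R₂, R₃⟩`,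
chosen so that the uniform side of step (3) splits in the order of the test's averages). [folklore] -/
def lay (U3 Y h3 U v2 h1 U1 : List Bool) : List Bool := U3 ++ Y ++ h3 ++ U ++ v2 ++ h1 ++ U1

/-- **The core of `g_{ẽ,p̃}` at level `N`, advice `a`**, on the seed `pcs ‖ U ‖ U₁ ‖ U₃`:
`lay U₃ Y' h₃(F') U h_U(blocks) h₁(pcs) U₁`. [cite: HastadImpagliazzoLevinLuby1999, Construction 7.0.4] -/
noncomputable def coreOut (N a : ℕ) (s : List Bool) : List Bool :=
  let pcs := s.take (P.Lp N)
  let U := (s.drop (P.Lp N)).take (P.uLen N (tOfA N a))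
  let U1 := (s.drop (P.Lp N + P.uLen N (tOfA N a))).take (P.key1 N a)
  let U3 := s.drop (P.Lp N + P.uLen N (tOfA N a) + P.key1 N a)
  lay U3 (P.yprimes N pcs) (hashStr (P.fLen N) (P.m3 N a) U3 (P.fprimes f N pcs)) U
    (hashStr (P.kk N * kL N) (P.m2 N a) U (P.blocks N [] false [] pcs)) (hashStr (P.Lp N) (P.m1 N a) U1 pcs) U1

/-- **The simulator of the computational step** on `β = α ‖ R`, `α = v₂ ‖ pubs ‖ U` a sample of `𝒟`/`ℰ`,
`R = Z₁ ‖ U₁ ‖ U₃`: `lay U₃ Y'(pubs) h₃(F'(pubs)) U v₂ Z₁ U₁`.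
[cite: HastadImpagliazzoLevinLuby1999, Thm 7.0.5 (proof, step (2): "from Lemma 6.3.2 and 6.1.1")] -/
noncomputable def phiStr (N a : ℕ) (β : List Bool) : List Bool :=
  let t := tOfA N a
  let α := β.take (P.sLen N t)
  let R := β.drop (P.sLen N t)
  let v2 := α.take (P.mlen N t)
  let pubs := (α.drop (P.mlen N t)).take (P.kk N * pubLen N)
  let U := α.drop (P.mlen N t + P.kk N * pubLen N)
  let Z1 := R.take (P.m1 N a)
  let U1 := (R.drop (P.m1 N a)).take (P.key1 N a)
  let U3 := R.drop (P.m1 N a + P.key1 N a)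
  lay U3 (P.yOfPubs N pubs) (hashStr (P.fLen N) (P.m3 N a) U3 (P.fOfPubs N pubs)) U v2 Z1 U1

/-! ### The hybrids of the proof of Theorem 7.0.5 -/

/-- `H₀`: the core output on a uniform seed. [cite: HastadImpagliazzoLevinLuby1999, Thm 7.0.5 (proof)] -/
noncomputable def X0 (aS : ℕ → ℕ) (N : ℕ) : PMF (List Bool) := (uniformBits (P.coreLen N (aS N))).map (P.coreOut f N (aS N))

/-- `H₁ = Φ(𝒟 ‖ R)`: `h₁(X')` replaced by uniform bits. [cite: HastadImpagliazzoLevinLuby1999, Thm 7.0.5 (proof, after step (1))] -/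
noncomputable def X1 (ΦF : List Bool → List Bool) (aS : ℕ → ℕ) (N : ℕ) : PMF (List Bool) :=
  ((P.Dens f N).bind fun α => (uniformBits (P.rLen N (aS N))).map fun R => α ++ R).map fun β =>
    ΦF (boolPair (unaryEncodeNat N) (boolPair (ones (aS N)) β))

/-- `H₂ = Φ(ℰ ‖ R)`: also `h₂(blocks)` replaced. [cite: HastadImpagliazzoLevinLuby1999, Thm 7.0.5 (proof, after step (2))] -/
noncomputable def X2 (ΦF : List Bool → List Bool) (aS : ℕ → ℕ) (N : ℕ) : PMF (List Bool) :=
  ((P.Eens f N).bind fun α => (uniformBits (P.rLen N (aS N))).map fun R => α ++ R).map fun β =>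
    ΦF (boolPair (unaryEncodeNat N) (boolPair (ones (aS N)) β))

/-- `H₃`: uniform bits. [cite: HastadImpagliazzoLevinLuby1999, Thm 7.0.5 (proof, after step (3))] -/
noncomputable def X3 (aS : ℕ → ℕ) (N : ℕ) : PMF (List Bool) := uniformBits (P.outLen N (aS N))

variable {P f}

/-- Lengths of the samples of `𝒟`. [folklore] -/
theorem length_of_mem_support_Dens (hlp : IsLengthPreserving f) (N : ℕ) : ∀ s ∈ (P.Dens f N).support, s.length = P.sLen N (tStar f N) := by
  intro s hs
  rw [Dens] at hs
  obtain ⟨r, hr, rfl⟩ := (PMF.mem_support_map_iff _ _ _).1 hs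
  have hrl := length_eq_of_mem_support_uniformBits hr
  exact length_Dsample hlp (τ := []) (by simp) (fun h => absurd h Bool.false_ne_true)
    (by rw [List.length_take, hrl]; exact Nat.min_eq_left (Nat.le_add_right _ _)) (by rw [List.length_drop, hrl]; omega)

/-- Lengths of the samples of `ℰ`. [folklore] -/
theorem length_of_mem_support_Eens (hlp : IsLengthPreserving f) (N : ℕ) : ∀ s ∈ (P.Eens f N).support, s.length = P.sLen N (tStar f N) := by
  intro s hs
  rw [Eens] at hs
  obtain ⟨r, hr, rfl⟩ := (PMF.mem_support_map_iff _ _ _).1 hs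
  have hrl := length_eq_of_mem_support_uniformBits hr
  exact length_Esample hlp (τ := []) (by simp) (fun h => absurd h Bool.false_ne_true)
    (by rw [List.length_take, hrl]; exact Nat.min_eq_left (by omega)) (by rw [List.length_take, List.length_drop, hrl]; omega)
    (by rw [List.length_drop, hrl]; omega)

/-- **Step (2) of the proof of Theorem 7.0.5**: `H₁ ≈_c H₂` — from `𝒟 ≈_c ℰ` (Lemmas 6.3.2/6.1.1,
`isCompIndistinguishable_DE`) by appending the fresh coins `R` of advice-determined length
(`append_uniform_adv`) and post-processing with the advice-receiving simulator `Φ` (`map_fp_advice`).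
[cite: HastadImpagliazzoLevinLuby1999, Thm 7.0.5 (proof, step (2))] -/
theorem isCompIndistinguishable_X1_X2 (hlp : IsLengthPreserving f) (hDE : IsCompIndistinguishable (P.Dens f) (P.Eens f))
    {ΦF : List Bool → List Bool} (hΦ : ΦF ∈ FP) {aS : ℕ → ℕ} (qA : Polynomial ℕ) (ha : ∀ N, aS N ≤ qA.eval N)
    (qR : Polynomial ℕ) (hR : ∀ N, P.rLen N (aS N) ≤ qR.eval N) (qS : Polynomial ℕ) (hS : ∀ N, P.sLen N (tStar f N) ≤ qS.eval N)
    {ℓ' : ℕ → ℕ} (hΦlen : ∀ N (β : List Bool), β.length = P.sLen N (tStar f N) + P.rLen N (aS N) →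
      (ΦF (boolPair (unaryEncodeNat N) (boolPair (ones (aS N)) β))).length = ℓ' N) :
    IsCompIndistinguishable (P.X1 f ΦF aS) (P.X2 f ΦF aS) := by
  have h1 := hDE.append_uniform_adv (length_of_mem_support_Dens hlp) (length_of_mem_support_Eens hlp) ⟨qS, hS⟩ qR hR
  have hlenX : ∀ N, ∀ s ∈ ((P.Dens f N).bind fun α => (uniformBits (P.rLen N (aS N))).map fun R => α ++ R).support,
      s.length = P.sLen N (tStar f N) + P.rLen N (aS N) := by
    intro N s hs
    obtain ⟨α, hα, hs'⟩ := (PMF.mem_support_bind_iff _ _ _).1 hs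
    obtain ⟨R, hRm, rfl⟩ := (PMF.mem_support_map_iff _ _ _).1 hs'
    rw [List.length_append, length_of_mem_support_Dens hlp N α hα, length_eq_of_mem_support_uniformBits hRm]
  have hlenY : ∀ N, ∀ s ∈ ((P.Eens f N).bind fun α => (uniformBits (P.rLen N (aS N))).map fun R => α ++ R).support,
      s.length = P.sLen N (tStar f N) + P.rLen N (aS N) := by
    intro N s hs
    obtain ⟨α, hα, hs'⟩ := (PMF.mem_support_bind_iff _ _ _).1 hs
    obtain ⟨R, hRm, rfl⟩ := (PMF.mem_support_map_iff _ _ _).1 hs'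
    rw [List.length_append, length_of_mem_support_Eens hlp N α hα, length_eq_of_mem_support_uniformBits hRm]
  exact h1.map_fp_advice hlenX hlenY ⟨qS + qR, fun N => by rw [eval_add]; exact Nat.add_le_add (hS N) (hR N)⟩ hΦ qA ha hΦlen

/-! ### Generic identities -/

/-- **Appending fresh uniform bits to a push-forward of uniform bits** is a push-forward of longer uniform
bits. [folklore] -/
theorem bind_append_uniform_eq_map (a b : ℕ) (G : List Bool → List Bool) :
    (((uniformBits a).map G).bind fun α => (uniformBits b).map fun R => α ++ R) =
      (uniformBits (a + b)).map fun s => G (s.take a) ++ s.drop a := by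
  rw [← PRGStretch.uniformBits_add a b, PMF.map_bind, PMF.bind_map]
  refine pmf_bind_congr_of_mem_support _ fun x hx => ?_
  have hxl : x.length = a := length_eq_of_mem_support_uniformBits hx
  rw [PMF.map_comp, Function.comp_def]
  show (uniformBits b).map (fun R => G x ++ R) = (uniformBits b).map fun y => G ((x ++ y).take a) ++ (x ++ y).drop a
  congr 1
  funext y
  rw [List.take_append_of_le_length hxl.ge, List.take_of_length_le hxl.le, List.drop_append_of_le_length hxl.ge,
    List.drop_of_length_le hxl.le, List.nil_append]

/-- **Entropy is invariant under relabelling the sample space by a bijection.** [folklore] -/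
theorem mapEntropy_comp_equiv {α β γ : Type*} [Fintype α] [Fintype β] [DecidableEq γ] (e : α ≃ β) (h : β → γ) :
    mapEntropy (Finset.univ : Finset α) (h ∘ e) = mapEntropy (Finset.univ : Finset β) h := by
  classical
  unfold mapEntropy
  rw [Finset.card_univ, Finset.card_univ, Fintype.card_congr e]
  congr 1
  refine Fintype.sum_equiv e _ _ fun a => ?_
  have hfib : (fiber (Finset.univ : Finset α) (h ∘ e) ((h ∘ e) a)).card = (fiber (Finset.univ : Finset β) h (h (e a))).card := by
    refine Finset.card_bij (fun x _ => e x) (fun x hx => ?_) (fun x _ y _ hxy => e.injective hxy) (fun y hy => ⟨e.symm y, ?_, e.apply_symm_apply y⟩)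
    · simp only [fiber, Finset.mem_filter, Finset.mem_univ, true_and, Function.comp_apply] at hx ⊢; exact hx
    · simp only [fiber, Finset.mem_filter, Finset.mem_univ, true_and, Function.comp_apply, Equiv.apply_symm_apply] at hy ⊢; exact hy
  rw [hfib]

/-- **The entropy of a pair of functions of independent uniform coordinates is the sum.** [cite: CoverThomas2006, Thm. 2.6.6 (independence bound, equality case)] -/
theorem mapEntropy_prod_pair {A B α β' : Type*} [Fintype A] [Fintype B] [Nonempty A] [Nonempty B] [DecidableEq α] [DecidableEq β']
    (F : A → α) (G : B → β') :
    mapEntropy (Finset.univ : Finset (A × B)) (fun v => (F v.1, G v.2)) = mapEntropy (Finset.univ : Finset A) F + mapEntropy (Finset.univ : Finset B) G := by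
  classical
  have hA : (0 : ℝ) < Fintype.card A := by exact_mod_cast Fintype.card_pos
  have hB : (0 : ℝ) < Fintype.card B := by exact_mod_cast Fintype.card_pos
  have hfib : ∀ a : A, ∀ b : B, ((fiber (Finset.univ : Finset (A × B)) (fun v => (F v.1, G v.2)) (F a, G b)).card : ℝ) =
      (fiber Finset.univ F (F a)).card * (fiber Finset.univ G (G b)).card := by
    intro a b
    have : fiber (Finset.univ : Finset (A × B)) (fun v => (F v.1, G v.2)) (F a, G b) = fiber Finset.univ F (F a) ×ˢ fiber Finset.univ G (G b) := by
      ext ⟨a', b'⟩; simp [fiber]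
    rw [this, Finset.card_product]; push_cast; ring
  unfold mapEntropy
  rw [Finset.card_univ, Finset.card_univ, Finset.card_univ, Fintype.card_prod, Fintype.sum_prod_type]
  dsimp only
  have hterm : ∀ a : A, ∀ b : B, Real.logb 2 (((Fintype.card A * Fintype.card B : ℕ) : ℝ) /
      (fiber (Finset.univ : Finset (A × B)) (fun v => (F v.1, G v.2)) (F a, G b)).card) =
      Real.logb 2 ((Fintype.card A : ℝ) / (fiber Finset.univ F (F a)).card) + Real.logb 2 ((Fintype.card B : ℝ) / (fiber Finset.univ G (G b)).card) := by
    intro a b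
    have hf : (0 : ℝ) < (fiber Finset.univ F (F a)).card := by exact_mod_cast card_fiber_pos _ (Finset.mem_univ a)
    have hg : (0 : ℝ) < (fiber Finset.univ G (G b)).card := by exact_mod_cast card_fiber_pos _ (Finset.mem_univ b)
    rw [hfib, ← Real.logb_mul (div_pos hA hf).ne' (div_pos hB hg).ne']
    congr 1; push_cast; field_simp
  simp only [hterm]
  have e2 : ∑ a : A, ∑ b : B, (Real.logb 2 ((Fintype.card A : ℝ) / (fiber Finset.univ F (F a)).card) + Real.logb 2 ((Fintype.card B : ℝ) / (fiber Finset.univ G (G b)).card)) =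
      Fintype.card B * ∑ a : A, Real.logb 2 ((Fintype.card A : ℝ) / (fiber Finset.univ F (F a)).card) +
        Fintype.card A * ∑ b : B, Real.logb 2 ((Fintype.card B : ℝ) / (fiber Finset.univ G (G b)).card) := by
    simp only [Finset.sum_add_distrib, Finset.sum_const, Finset.card_univ, nsmul_eq_mul]
    rw [← Finset.mul_sum]
  rw [e2]
  push_cast
  field_simp

/-- **Sums over `𝔽₂^m` are sums over `m`-bit strings** (through `encZ`). [folklore] -/
theorem sum_encZ_eq_sum_vector (m : ℕ) (G : List Bool → ℝ) :
    ∑ u : Fin m → ZMod 2, G (encZ m u) = ∑ v : List.Vector Bool m, G v.toList := by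
  classical
  let e : (Fin m → ZMod 2) → List.Vector Bool m := fun u => ⟨encZ m u, length_encZ m u⟩
  have hinj : Function.Injective e := fun u u' h => encZ_injective m (congrArg List.Vector.toList h)
  have hbij : Function.Bijective e := by
    refine (Fintype.bijective_iff_injective_and_card e).2 ⟨hinj, ?_⟩
    rw [Fintype.card_fun, Fintype.card_fin, ZMod.card, card_vector, Fintype.card_bool]
  exact Fintype.sum_bijective e hbij _ _ fun u => rfl

/-- Post-composition with an injective map does not change the entropy. [folklore] -/
theorem mapEntropy_comp_injective {α β γ : Type*} [Fintype α] [DecidableEq β] [DecidableEq γ] (h : α → β) {ι : β → γ} (hι : Function.Injective ι) :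
    mapEntropy (Finset.univ : Finset α) (ι ∘ h) = mapEntropy (Finset.univ : Finset α) h := by
  classical
  unfold mapEntropy
  congr 1
  refine Finset.sum_congr rfl fun v _ => ?_
  have : fiber (Finset.univ : Finset α) (ι ∘ h) ((ι ∘ h) v) = fiber Finset.univ h (h v) := by
    ext w; simp only [fiber, Finset.mem_filter, Finset.mem_univ, true_and, Function.comp_apply]; exact hι.eq_iff
  rw [this]

/-! ### The position coins as a product: `pc = w ‖ ρ ‖ σ ‖ u` -/

/-- The coins `(w, ρ)` of `f'` at level `N`. [folklore] -/
abbrev WR (N : ℕ) := List.Vector Bool N × List.Vector Bool (rlen N)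

/-- The GL coins `σ`. [folklore] -/
abbrev SG (N : ℕ) := List.Vector Bool (kL N * N)

/-- The unused slot `u`. [folklore] -/
abbrev UU (N : ℕ) := List.Vector Bool (kL N)

/-- The position coins. [folklore] -/
abbrev PC (N : ℕ) := List.Vector Bool (cP N)

/-- **`{0,1}^{cP} ≃ ((w, ρ), σ), u`.** [folklore] -/
def pcSplit (N : ℕ) : PC N ≃ (WR N × SG N) × UU N where
  toFun pc := (((⟨pcW N pc.toList, length_pcW pc.toList_length⟩, ⟨pcR N pc.toList, length_pcR pc.toList_length⟩),
    ⟨pcS N pc.toList, length_pcS pc.toList_length⟩), ⟨pcU N pc.toList, length_pcU pc.toList_length⟩)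
  invFun v := ⟨v.1.1.1.toList ++ v.1.1.2.toList ++ v.1.2.toList ++ v.2.toList, by
    simp only [List.length_append, List.Vector.toList_length, cP]⟩
  left_inv pc := by
    apply List.Vector.toList_injective
    exact (pc_eq_append pc.toList_length).symm
  right_inv v := by
    obtain ⟨⟨⟨w, ρ⟩, σ⟩, u⟩ := v
    have hw := w.toList_length; have hρ := ρ.toList_length; have hσ := σ.toList_length; have hu := u.toList_length
    have e1 : pcW N (w.toList ++ ρ.toList ++ σ.toList ++ u.toList) = w.toList := by
      rw [pcW, List.append_assoc, List.append_assoc, List.take_append_of_le_length hw.ge, List.take_of_length_le hw.le]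
    have e2 : pcR N (w.toList ++ ρ.toList ++ σ.toList ++ u.toList) = ρ.toList := by
      rw [pcR, List.append_assoc, List.append_assoc, List.drop_append_of_le_length hw.ge, List.drop_of_length_le hw.le, List.nil_append,
        List.take_append_of_le_length hρ.ge, List.take_of_length_le hρ.le]
    have e3 : pcS N (w.toList ++ ρ.toList ++ σ.toList ++ u.toList) = σ.toList := by
      rw [pcS, List.append_assoc, show w.toList ++ ρ.toList ++ (σ.toList ++ u.toList) = (w.toList ++ ρ.toList) ++ (σ.toList ++ u.toList) by
        simp only [List.append_assoc], List.drop_append_of_le_length (by rw [List.length_append, hw, hρ]),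
        List.drop_of_length_le (by rw [List.length_append, hw, hρ]), List.nil_append, List.take_append_of_le_length hσ.ge,
        List.take_of_length_le hσ.le]
    have e4 : pcU N (w.toList ++ ρ.toList ++ σ.toList ++ u.toList) = u.toList := by
      rw [pcU, List.drop_append_of_le_length (by rw [List.length_append, List.length_append, hw, hρ, hσ]),
        List.drop_of_length_le (by rw [List.length_append, List.length_append, hw, hρ, hσ]), List.nil_append, List.take_of_length_le hu.le]
    simp only [Prod.mk.injEq]
    exact ⟨⟨⟨List.Vector.toList_injective e1, List.Vector.toList_injective e2⟩, List.Vector.toList_injective e3⟩, List.Vector.toList_injective e4⟩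

/-- Components of `pcSplit`. [folklore] -/
theorem pcSplit_fst_fst (N : ℕ) (pc : PC N) : ((pcSplit N pc).1.1.1.toList, (pcSplit N pc).1.1.2.toList) = (pcW N pc.toList, pcR N pc.toList) := rfl

/-- A component of `pcSplit`. [folklore] -/
theorem pcSplit_snd_toList (N : ℕ) (pc : PC N) : (pcSplit N pc).1.2.toList = pcS N pc.toList := rfl

/-- A component of `pcSplit`. [folklore] -/
theorem pcSplit_u_toList (N : ℕ) (pc : PC N) : (pcSplit N pc).2.toList = pcU N pc.toList := rfl

/-! ### The per-copy source of step (1): `x = pc`, `y = (f'(w,ρ), σ, GL_K(w, σ))` -/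

variable (f)

/-- The side information of one copy in step (1), on the product. [cite: HastadImpagliazzoLevinLuby1999, Thm 7.0.5 (proof, step (1): "given f'(X) and b(X,Y)")] -/
noncomputable def Yside (N : ℕ) (q : WR N × SG N) : List Bool × SG N × List Bool :=
  (Ent.fvalV f N q.1, q.2, glBits (kL N) N q.1.1.toList q.2.toList)

/-- The side information of one copy in step (1), on the position coins. [folklore] -/
noncomputable def y1 (N : ℕ) (pc : PC N) : List Bool × SG N × List Bool := Yside f N (pcSplit N pc).1

/-- The Shannon entropy `eₙ` of `f'(W, R)`. [cite: HastadImpagliazzoLevinLuby1999, §6.2 (eₙ = the entropy of f'ₙ)] -/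
noncomputable def entN (N : ℕ) : ℝ := mapEntropy (Finset.univ : Finset (WR N)) (Ent.fvalV f N)

/-- `Pr[(w, ρ) not determined by f'(w, ρ)]`. [folklore] -/
noncomputable def pND (N : ℕ) : ℝ :=
  (((Finset.univ : Finset (WR N)).filter fun v => ¬ Ent.Det (Ent.fvalV f N) v).card : ℝ) / Fintype.card (WR N)

variable {f}

/-- `y1` is `Yside ∘ fst ∘ pcSplit`. [folklore] -/
theorem y1_comp_symm (N : ℕ) : (y1 f N) ∘ (pcSplit N).symm = fun v : (WR N × SG N) × UU N => Yside f N v.1 := by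
  funext v; simp [y1, Function.comp_apply, Equiv.apply_symm_apply]

/-- **The conditional entropy of one copy in step (1)**:
`H(pc | f'(w,ρ), σ, GL_K(w,σ)) ≥ (N + rlen + K) − eₙ − K·Pr[¬Det]`.
[cite: HastadImpagliazzoLevinLuby1999, Thm 7.0.5 (proof: "the conditional entropy of 𝒳 given f'(𝒳) and b(𝒳,Y) is at least cₙ − eₙ − pₙ + 1/(2n)")] -/
theorem condEnt_step1 (N : ℕ) :
    ((N + rlen N + kL N : ℕ) : ℝ) - entN f N - kL N * pND f N ≤
      mapEntropy (Finset.univ : Finset (PC N)) (fun pc => (pc, y1 f N pc)) - mapEntropy (Finset.univ : Finset (PC N)) (y1 f N) := by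
  classical
  -- the joint map is injective
  have hinj : Function.Injective (fun pc : PC N => (pc, y1 f N pc)) := fun a b h => (Prod.mk.inj h).1
  rw [Ent.mapEntropy_of_injective hinj]
  -- transport `y1` to the product and drop `u`
  have hy : mapEntropy (Finset.univ : Finset (PC N)) (y1 f N) = mapEntropy (Finset.univ : Finset (WR N × SG N)) (Yside f N) := by
    rw [← mapEntropy_comp_equiv (pcSplit N).symm (y1 f N), y1_comp_symm]
    exact Ent.mapEntropy_comp_fst (A := WR N × SG N) (U := UU N) (Yside f N)
  rw [hy]
  -- the generic bound on `WR × SG`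
  have hγ : ∀ (F : Finset (WR N)) (σ : SG N), (F.image fun q : WR N => glBits (kL N) N q.1.toList σ.toList).card ≤ 2 ^ kL N := fun F σ =>
    card_le_two_pow_of_length_eq fun s hs => by
      obtain ⟨q, -, rfl⟩ := Finset.mem_image.1 hs
      exact length_glBits _ _ _ _
  have hge := Ent.condEntropy_ge (Ω₀ := WR N) (Sg := SG N) (Ent.fvalV f N) (fun (q : WR N) (σ : SG N) => glBits (kL N) N q.1.toList σ.toList) (kL N) hγ
  have hinj2 : Function.Injective (fun v : WR N × SG N => (v.1, (Ent.fvalV f N v.1, v.2, glBits (kL N) N v.1.1.toList v.2.toList))) :=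
    fun a b h => by
      have h1 := (Prod.mk.inj h).1
      have h2 := (Prod.mk.inj (Prod.mk.inj (Prod.mk.inj h).2).2).1
      exact Prod.ext h1 h2
  rw [Ent.mapEntropy_of_injective hinj2] at hge
  have hYs : (fun v : WR N × SG N => (Ent.fvalV f N v.1, v.2, glBits (kL N) N v.1.1.toList v.2.toList)) = Yside f N := rfl
  rw [hYs] at hge
  -- cardinalities
  have hPC : (Fintype.card (PC N) : ℝ) = 2 ^ cP N := by rw [card_vector, Fintype.card_bool]; push_cast; ring
  have hWR : (Fintype.card (WR N) : ℝ) = 2 ^ (N + rlen N) := by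
    rw [Fintype.card_prod, card_vector, card_vector, Fintype.card_bool, pow_add]; push_cast; ring
  have hWS : (Fintype.card (WR N × SG N) : ℝ) = 2 ^ (N + rlen N + kL N * N) := by
    rw [Fintype.card_prod, Fintype.card_prod, card_vector, card_vector, card_vector, Fintype.card_bool, pow_add, pow_add]; push_cast; ring
  have hlog : ∀ n : ℕ, Real.logb 2 ((2 : ℝ) ^ n) = n := fun n => by
    rw [Real.logb_pow, Real.logb_self_eq_one one_lt_two, mul_one]
  rw [hPC, hlog]
  rw [hWR, hWS, hlog, hlog] at hge
  unfold entN pND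
  rw [hWR]
  have hcP : (cP N : ℝ) = (N + rlen N + kL N * N : ℕ) + kL N := by rw [cP]; push_cast; ring
  rw [hcP]
  push_cast at hge ⊢
  rw [mul_div_assoc] at hge
  linarith

/-- `Pr[¬Det] ≤ p₀ − 2^{−b} + 2^{1−eLen}` (`HILLEntropy.prob_notDet_le`). [cite: HastadImpagliazzoLevinLuby1999, Lemma 6.3.1 (proof)] -/
theorem pND_le (hlp : IsLengthPreserving f) {N : ℕ} (hN : 1 ≤ N) :
    pND f N ≤ ((T f 0 N).card : ℝ) / 2 ^ N - 1 / 2 ^ bLen N + 2 / 2 ^ eLen N :=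
  Ent.prob_notDet_le hlp hN

/-- Maps with the same kernel have the same entropy. [folklore] -/
theorem mapEntropy_eq_of_ker_eq {α β γ : Type*} [Fintype α] [DecidableEq β] [DecidableEq γ] {h₁ : α → β} {h₂ : α → γ}
    (hker : ∀ v w, h₁ w = h₁ v ↔ h₂ w = h₂ v) : mapEntropy (Finset.univ : Finset α) h₁ = mapEntropy (Finset.univ : Finset α) h₂ := by
  classical
  unfold mapEntropy
  congr 1
  refine Finset.sum_congr rfl fun v _ => ?_
  have : fiber (Finset.univ : Finset α) h₁ (h₁ v) = fiber Finset.univ h₂ (h₂ v) := by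
    ext w; simp only [fiber, Finset.mem_filter, Finset.mem_univ, true_and]; exact hker v w
  rw [this]

/-- A constant map has entropy `0`. [folklore] -/
theorem mapEntropy_const' {α β : Type*} [Fintype α] [DecidableEq β] (b : β) : mapEntropy (Finset.univ : Finset α) (fun _ : α => b) = 0 := by
  classical
  unfold mapEntropy
  have hfib : fiber (Finset.univ : Finset α) (fun _ : α => b) b = Finset.univ := by ext w; simp [fiber]
  simp only [hfib, Finset.card_univ]
  rcases Nat.eq_zero_or_pos (Fintype.card α) with h0 | hpos
  · simp [h0]
  · rw [div_self (by exact_mod_cast hpos.ne' : (Fintype.card α : ℝ) ≠ 0), Real.logb_one]; simp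

/-! ### The per-copy source of step (3): `x = f'(w,ρ)`, `y = σ` -/

/-- Pad/truncate to length `Lg N` (the identity on values of `f'` for length-preserving `f`). [folklore] -/
def gFix (N : ℕ) (l : List Bool) : List Bool := (l ++ List.replicate (Lg N) false).take (Lg N)

/-- `|gFix l| = Lg N`. [folklore] -/
theorem length_gFix (N : ℕ) (l : List Bool) : (gFix N l).length = Lg N := by
  rw [gFix, List.length_take, List.length_append, List.length_replicate]; omega

/-- `gFix` is the identity on strings of the right length. [folklore] -/
theorem gFix_eq {N : ℕ} {l : List Bool} (h : l.length = Lg N) : gFix N l = l := by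
  rw [gFix, List.take_append_of_le_length h.ge, List.take_of_length_le h.le]

variable (f)

/-- `f'(w, ρ)` as a vector. [folklore] -/
noncomputable def GV (N : ℕ) (q : WR N) : List.Vector Bool (Lg N) := ⟨gFix N (Ent.fvalV f N q), length_gFix N _⟩

/-- The hashed value of one copy in step (3): `f'(w_j, ρ_j)`. [cite: HastadImpagliazzoLevinLuby1999, Thm 7.0.5 (proof, step (3): "the entropy of f'^{kₙ}(X') is kₙeₙ")] -/
noncomputable def x3 (N : ℕ) (pc : PC N) : List.Vector Bool (Lg N) := GV f N (pcSplit N pc).1.1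

variable {f}

/-- The side information of one copy in step (3): `σ_j` (independent of `f'(w_j, ρ_j)`). [folklore] -/
def y3 (N : ℕ) (pc : PC N) : SG N := (pcSplit N pc).1.2

/-- `GV` has the kernel of `f'` (for length-preserving `f`). [folklore] -/
theorem GV_eq_iff (hlp : IsLengthPreserving f) {N : ℕ} (v w : WR N) : GV f N w = GV f N v ↔ Ent.fvalV f N w = Ent.fvalV f N v := by
  have hl : ∀ q : WR N, (Ent.fvalV f N q).length = Lg N := fun q =>
    length_g hlp q.1.toList_length q.2.toList_length
  constructor
  · intro h
    have := congrArg List.Vector.toList h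
    change gFix N (Ent.fvalV f N w) = gFix N (Ent.fvalV f N v) at this
    rwa [gFix_eq (hl w), gFix_eq (hl v)] at this
  · intro h; simp only [GV, h]

/-- **The conditional entropy of one copy in step (3)**: `H(f'(w,ρ) | σ) = eₙ`. [cite: HastadImpagliazzoLevinLuby1999, Thm 7.0.5 (proof, step (3))] -/
theorem condEnt_step3 (hlp : IsLengthPreserving f) (N : ℕ) :
    mapEntropy (Finset.univ : Finset (PC N)) (fun pc => (x3 f N pc, y3 N pc)) - mapEntropy (Finset.univ : Finset (PC N)) (y3 N) = entN f N := by
  classical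
  -- transport to the product
  have h1 : mapEntropy (Finset.univ : Finset (PC N)) (fun pc => (x3 f N pc, y3 N pc)) =
      mapEntropy (Finset.univ : Finset (WR N × SG N)) (fun q => (GV f N q.1, q.2)) := by
    rw [← mapEntropy_comp_equiv (pcSplit N).symm (fun pc => (x3 f N pc, y3 N pc))]
    have : (fun pc => (x3 f N pc, y3 N pc)) ∘ (pcSplit N).symm = fun v : (WR N × SG N) × UU N => (fun q : WR N × SG N => (GV f N q.1, q.2)) v.1 := by
      funext v; simp [x3, y3, Function.comp_apply, Equiv.apply_symm_apply]
    rw [this]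
    exact Ent.mapEntropy_comp_fst (A := WR N × SG N) (U := UU N) (fun q : WR N × SG N => (GV f N q.1, q.2))
  have h2 : mapEntropy (Finset.univ : Finset (PC N)) (y3 N) = mapEntropy (Finset.univ : Finset (WR N × SG N)) (fun q => q.2) := by
    rw [← mapEntropy_comp_equiv (pcSplit N).symm (y3 N)]
    have : (y3 N) ∘ (pcSplit N).symm = fun v : (WR N × SG N) × UU N => (fun q : WR N × SG N => q.2) v.1 := by
      funext v; simp [y3, Function.comp_apply, Equiv.apply_symm_apply]
    rw [this]
    exact Ent.mapEntropy_comp_fst (A := WR N × SG N) (U := UU N) (fun q : WR N × SG N => q.2)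
  rw [h1, h2]
  -- the pair: `H(GV) + H(id)`; the second component alone: `H(const) + H(id)`
  have h3 : mapEntropy (Finset.univ : Finset (WR N × SG N)) (fun q => (GV f N q.1, q.2)) =
      mapEntropy (Finset.univ : Finset (WR N)) (GV f N) + mapEntropy (Finset.univ : Finset (SG N)) (fun σ : SG N => σ) :=
    mapEntropy_prod_pair (GV f N) (fun σ : SG N => σ)
  have h4 : mapEntropy (Finset.univ : Finset (WR N × SG N)) (fun q => q.2) =
      mapEntropy (Finset.univ : Finset (WR N)) (fun _ : WR N => ()) + mapEntropy (Finset.univ : Finset (SG N)) (fun σ : SG N => σ) := by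
    rw [← mapEntropy_prod_pair (fun _ : WR N => ()) (fun σ : SG N => σ)]
    exact mapEntropy_eq_of_ker_eq fun v w => by simp
  have h5 : mapEntropy (Finset.univ : Finset (WR N)) (GV f N) = entN f N := mapEntropy_eq_of_ker_eq (GV_eq_iff hlp)
  rw [h3, h4, h5, mapEntropy_const']
  ring

/-! ### From `range`-indexed concatenations to `Fin`-indexed ones -/

/-- `((range k).map F).flatten = (ofFn (F ∘ val)).flatten`. [folklore] -/
theorem flatten_map_range_eq_ofFn (k : ℕ) (F : ℕ → List Bool) : ((List.range k).map F).flatten = (List.ofFn fun i : Fin k => F i).flatten := by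
  rw [List.ofFn_eq_map, ← List.map_coe_finRange_eq_range, List.map_map]; rfl

/-- The long vector of a tuple is the concatenation of its components. [folklore] -/
theorem toList_tupleVecEquiv {t m : ℕ} (ω : Fin t → List.Vector Bool m) : (tupleVecEquiv t m ω).toList = (List.ofFn fun i => (ω i).toList).flatten := by
  have h := flatten_ofFn_block (m := m) (t := t) (tupleVecEquiv t m ω).toList (tupleVecEquiv t m ω).toList_length
  conv_lhs => rw [← h]
  congr 1
  exact List.ofFn_inj.2 (funext fun i => block_tupleVecEquiv ω i)

/-- A string of `t` blocks is the concatenation of its blocks. [folklore] -/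
theorem flatten_ofFn_blkL {t m : ℕ} {r : List Bool} (hr : r.length = t * m) : (List.ofFn fun i : Fin t => Greedy.blkL m i r).flatten = r :=
  flatten_ofFn_block r hr

variable (P f)

/-- `blocks` for the empty template, `Fin`-indexed. [folklore] -/
theorem blocks_nil_eq (N : ℕ) (pcs : List Bool) : P.blocks N [] false [] pcs =
    (List.ofFn fun i : Fin (P.kk N) => glBits (kL N) N (pcW N (Greedy.blkL (cP N) i pcs)) (pcS N (Greedy.blkL (cP N) i pcs))).flatten := by
  rw [blocks, flatten_map_range_eq_ofFn]; simp only [posBlk_nil]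

/-- `fprimes`, `Fin`-indexed. [folklore] -/
theorem fprimes_eq (N : ℕ) (pcs : List Bool) : P.fprimes f N pcs =
    (List.ofFn fun i : Fin (P.kk N) => g f (pcW N (Greedy.blkL (cP N) i pcs) ++ pcR N (Greedy.blkL (cP N) i pcs))).flatten := by
  rw [fprimes, flatten_map_range_eq_ofFn]

/-- `yprimes`, `Fin`-indexed. [folklore] -/
theorem yprimes_eq (N : ℕ) (pcs : List Bool) : P.yprimes N pcs = (List.ofFn fun i : Fin (P.kk N) => pcS N (Greedy.blkL (cP N) i pcs)).flatten := by
  rw [yprimes, flatten_map_range_eq_ofFn]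

/-- **Value of `coreOut` on a parsed seed.** [folklore] -/
theorem coreOut_append (N a : ℕ) {pcs U U1 U3 : List Bool} (hpcs : pcs.length = P.Lp N) (hU : U.length = P.uLen N (tOfA N a)) (hU1 : U1.length = P.key1 N a) :
    P.coreOut f N a (pcs ++ U ++ U1 ++ U3) = lay U3 (P.yprimes N pcs) (hashStr (P.fLen N) (P.m3 N a) U3 (P.fprimes f N pcs)) U
      (hashStr (P.kk N * kL N) (P.m2 N a) U (P.blocks N [] false [] pcs)) (hashStr (P.Lp N) (P.m1 N a) U1 pcs) U1 := by
  have e1 : (pcs ++ U ++ U1 ++ U3).take (P.Lp N) = pcs := by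
    rw [List.append_assoc, List.append_assoc, List.take_append_of_le_length hpcs.ge, List.take_of_length_le hpcs.le]
  have e2 : ((pcs ++ U ++ U1 ++ U3).drop (P.Lp N)).take (P.uLen N (tOfA N a)) = U := by
    rw [List.append_assoc, List.append_assoc, List.drop_append_of_le_length hpcs.ge, List.drop_of_length_le hpcs.le, List.nil_append,
      List.take_append_of_le_length hU.ge, List.take_of_length_le hU.le]
  have e3 : ((pcs ++ U ++ U1 ++ U3).drop (P.Lp N + P.uLen N (tOfA N a))).take (P.key1 N a) = U1 := by
    rw [List.append_assoc, List.drop_append_of_le_length (by rw [List.length_append, hpcs, hU]),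
      List.drop_of_length_le (by rw [List.length_append, hpcs, hU]), List.nil_append, List.take_append_of_le_length hU1.ge, List.take_of_length_le hU1.le]
  have e4 : (pcs ++ U ++ U1 ++ U3).drop (P.Lp N + P.uLen N (tOfA N a) + P.key1 N a) = U3 := by
    rw [List.drop_append_of_le_length (by rw [List.length_append, List.length_append, hpcs, hU, hU1]),
      List.drop_of_length_le (by rw [List.length_append, List.length_append, hpcs, hU, hU1]), List.nil_append]
  simp only [coreOut, e1, e2, e3, e4]

/-! ### Step (1): the acceptance probabilities as the averages of `extract_cond_test_smooth` -/

/-- The acceptance probability of `D` on `⟨1^N, x⟩`. [folklore] -/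
noncomputable def pD (D : RandAlg (List Bool) Bool) (N : ℕ) (x : List Bool) : ℝ := (D.outputPMF id (boolPair (unaryEncodeNat N) x) true).toReal

/-- The output assembled from `h₁`'s value, the side tuple of step (1) and the other coins. [folklore] -/
noncomputable def assemble1 (N a : ℕ) (z : Fin (P.kk N) → List Bool × SG N × List Bool) (h1 U U3 U1 : List Bool) : List Bool :=
  lay U3 (List.ofFn fun i => (z i).2.1.toList).flatten (hashStr (P.fLen N) (P.m3 N a) U3 (List.ofFn fun i => (z i).1).flatten) U
    (hashStr (P.kk N * kL N) (P.m2 N a) U (List.ofFn fun i => (z i).2.2).flatten) h1 U1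

/-- **The test of step (1)**: average acceptance over the remaining coins `U, U₃`, given the side tuple, the key
`U₁` and a candidate value of `h₁`. [cite: HastadImpagliazzoLevinLuby1999, Thm 7.0.5 (proof, step (1))] -/
noncomputable def F1 (D : RandAlg (List Bool) Bool) (N a : ℕ) (z : Fin (P.kk N) → List Bool × SG N × List Bool)
    (p : List.Vector Bool (P.key1 N a) × (Fin (P.m1 N a) → ZMod 2)) : ℝ :=
  uniformAvg (P.uLen N (tOfA N a)) fun U => uniformAvg (P.key3 N a) fun U3 => pD D N (P.assemble1 N a z (encZ (P.m1 N a) p.2) U U3 p.1.toList)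

variable {P f}

/-- `0 ≤ pD ≤ 1`. [folklore] -/
theorem pD_mem (D : RandAlg (List Bool) Bool) (N : ℕ) (x : List Bool) : 0 ≤ pD D N x ∧ pD D N x ≤ 1 := by
  unfold pD
  exact ⟨ENNReal.toReal_nonneg, ENNReal.toReal_le_of_le_ofReal zero_le_one (by rw [ENNReal.ofReal_one]; exact PMF.coe_le_one _ _)⟩

/-- `0 ≤ F1 ≤ 1`. [folklore] -/
theorem F1_mem (D : RandAlg (List Bool) Bool) (N a : ℕ) (z : Fin (P.kk N) → List Bool × SG N × List Bool) (p : List.Vector Bool (P.key1 N a) × (Fin (P.m1 N a) → ZMod 2)) :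
    0 ≤ P.F1 D N a z p ∧ P.F1 D N a z p ≤ 1 :=
  ⟨uniformAvg_nonneg fun _ => uniformAvg_nonneg fun _ => (pD_mem D N _).1, uniformAvg_le_one fun _ => uniformAvg_le_one fun _ => (pD_mem D N _).2⟩

/-- **The per-`pcs` integrand of step (1) in block form.** [folklore] -/
theorem inner1_eq (D : RandAlg (List Bool) Bool) (N a : ℕ) (U1 : List.Vector Bool (P.key1 N a)) (ω : Fin (P.kk N) → PC N) :
    (uniformAvg (P.uLen N (tOfA N a)) fun U => uniformAvg (P.key3 N a) fun U3 =>
      pD D N (lay U3 (List.ofFn fun i : Fin (P.kk N) => pcS N (ω i).toList).flatten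
        (hashStr (P.fLen N) (P.m3 N a) U3 (List.ofFn fun i : Fin (P.kk N) => g f (pcW N (ω i).toList ++ pcR N (ω i).toList)).flatten) U
        (hashStr (P.kk N * kL N) (P.m2 N a) U (List.ofFn fun i : Fin (P.kk N) => glBits (kL N) N (pcW N (ω i).toList) (pcS N (ω i).toList)).flatten)
        (hashStr (P.Lp N) (P.m1 N a) U1.toList (List.ofFn fun i => (ω i).toList).flatten) U1.toList)) =
      P.F1 D N a (Extract.ztup (y1 f N) ω) (U1, hashV (P.kk N * cP N) (P.m1 N a) U1.toList (Extract.xvec (fun pc : PC N => pc) ω)) := by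
  have hx : Extract.xvec (fun pc : PC N => pc) ω = tupleVecEquiv (P.kk N) (cP N) ω := rfl
  have hh : hashStr (P.Lp N) (P.m1 N a) U1.toList (List.ofFn fun i => (ω i).toList).flatten =
      encZ (P.m1 N a) (hashV (P.kk N * cP N) (P.m1 N a) U1.toList (Extract.xvec (fun pc : PC N => pc) ω)) := by
    rw [hx, ← toList_tupleVecEquiv, Lp, hashStr_toList]
  rw [hh]
  rfl

/-- **`Pr[D(H₀) = 1]` as the real-side average of the extraction lemma.** [cite: HastadImpagliazzoLevinLuby1999, Thm 7.0.5 (proof, step (1))] -/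
theorem prX0_eq (D : RandAlg (List Bool) Bool) (N a : ℕ) :
    (acceptPMF D N ((uniformBits (P.coreLen N a)).map (P.coreOut f N a)) true).toReal =
      (∑ U1 : List.Vector Bool (P.key1 N a), ∑ ω : Fin (P.kk N) → PC N,
        P.F1 D N a (Extract.ztup (y1 f N) ω) (U1, hashV (P.kk N * cP N) (P.m1 N a) U1.toList (Extract.xvec (fun pc : PC N => pc) ω))) /
        (2 ^ P.key1 N a * 2 ^ P.Lp N) := by
  rw [acceptPMF_map_uniformBits_toReal]
  unfold coreLen
  simp only [uniformAvg_append]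
  -- parse the seed inside the averages
  rw [uniformAvg_congr fun pcs hpcs => uniformAvg_congr fun U hU => uniformAvg_congr fun U1 hU1 => uniformAvg_congr fun U3 _ =>
    show (D.outputPMF id (boolPair (unaryEncodeNat N) (P.coreOut f N a (pcs ++ U ++ U1 ++ U3))) true).toReal =
      pD D N (lay U3 (P.yprimes N pcs) (hashStr (P.fLen N) (P.m3 N a) U3 (P.fprimes f N pcs)) U
        (hashStr (P.kk N * kL N) (P.m2 N a) U (P.blocks N [] false [] pcs)) (hashStr (P.Lp N) (P.m1 N a) U1 pcs) U1) by rw [coreOut_append P f N a hpcs hU hU1]; rfl]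
  -- reorder: `U₁` outermost, then `pcs`
  rw [uniformAvg_congr fun pcs _ => uniformAvg_comm (P.uLen N (tOfA N a)) (P.key1 N a) (fun U U1 => uniformAvg (P.key3 N a) fun U3 =>
    pD D N (lay U3 (P.yprimes N pcs) (hashStr (P.fLen N) (P.m3 N a) U3 (P.fprimes f N pcs)) U
      (hashStr (P.kk N * kL N) (P.m2 N a) U (P.blocks N [] false [] pcs)) (hashStr (P.Lp N) (P.m1 N a) U1 pcs) U1))]
  rw [uniformAvg_comm (P.Lp N) (P.key1 N a)]
  -- block form of the `pcs`-average
  have hblk : ∀ U1 : List Bool, uniformAvg (P.Lp N) (fun pcs => uniformAvg (P.uLen N (tOfA N a)) fun U => uniformAvg (P.key3 N a) fun U3 =>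
      pD D N (lay U3 (P.yprimes N pcs) (hashStr (P.fLen N) (P.m3 N a) U3 (P.fprimes f N pcs)) U
        (hashStr (P.kk N * kL N) (P.m2 N a) U (P.blocks N [] false [] pcs)) (hashStr (P.Lp N) (P.m1 N a) U1 pcs) U1)) =
      (∑ ω : Fin (P.kk N) → PC N, uniformAvg (P.uLen N (tOfA N a)) fun U => uniformAvg (P.key3 N a) fun U3 =>
        pD D N (lay U3 (List.ofFn fun i : Fin (P.kk N) => pcS N (ω i).toList).flatten
          (hashStr (P.fLen N) (P.m3 N a) U3 (List.ofFn fun i : Fin (P.kk N) => g f (pcW N (ω i).toList ++ pcR N (ω i).toList)).flatten) U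
          (hashStr (P.kk N * kL N) (P.m2 N a) U (List.ofFn fun i : Fin (P.kk N) => glBits (kL N) N (pcW N (ω i).toList) (pcS N (ω i).toList)).flatten)
          (hashStr (P.Lp N) (P.m1 N a) U1 (List.ofFn fun i => (ω i).toList).flatten) U1)) / 2 ^ (P.kk N * cP N) := by
    intro U1
    have h := GAvg.uniformAvg_blocks (P.kk N) (cP N) (fun bl => uniformAvg (P.uLen N (tOfA N a)) fun U => uniformAvg (P.key3 N a) fun U3 =>
      pD D N (lay U3 (List.ofFn fun i : Fin (P.kk N) => pcS N (bl i)).flatten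
        (hashStr (P.fLen N) (P.m3 N a) U3 (List.ofFn fun i : Fin (P.kk N) => g f (pcW N (bl i) ++ pcR N (bl i))).flatten) U
        (hashStr (P.kk N * kL N) (P.m2 N a) U (List.ofFn fun i : Fin (P.kk N) => glBits (kL N) N (pcW N (bl i)) (pcS N (bl i))).flatten)
        (hashStr (P.Lp N) (P.m1 N a) U1 (List.ofFn bl).flatten) U1))
    dsimp only at h
    rw [← h, Lp]
    refine uniformAvg_congr fun pcs hpcs => ?_
    rw [flatten_ofFn_blkL hpcs, ← blocks_nil_eq, ← fprimes_eq, ← yprimes_eq]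
  rw [uniformAvg]
  simp only [hblk, inner1_eq]
  rw [Finset.sum_div]
  conv_rhs => rw [Finset.sum_div]
  refine Finset.sum_congr rfl fun U1 _ => ?_
  rw [div_div, mul_comm ((2 : ℝ) ^ (P.kk N * cP N))]
  rfl

/-- **Value of the simulator on `𝒟`-sample ‖ R`** (correct density advice). [folklore] -/
theorem phiStr_Dsample (hlp : IsLengthPreserving f) {N a : ℕ} (ht : tOfA N a = tStar f N) {pcs U Z1 U1 U3 : List Bool}
    (hpcs : pcs.length = P.Lp N) (hU : U.length = P.uLen N (tStar f N)) (hZ1 : Z1.length = P.m1 N a) (hU1 : U1.length = P.key1 N a) :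
    P.phiStr N a (P.Dsample f N (tStar f N) [] false [] pcs U ++ (Z1 ++ U1 ++ U3)) =
      lay U3 (P.yprimes N pcs) (hashStr (P.fLen N) (P.m3 N a) U3 (P.fprimes f N pcs)) U
        (hashStr (P.kk N * kL N) (P.mlen N (tStar f N)) U (P.blocks N [] false [] pcs)) Z1 U1 := by
  have hD : (P.Dsample f N (tStar f N) [] false [] pcs U).length = P.sLen N (tStar f N) :=
    length_Dsample hlp (τ := []) (by simp) (fun h => absurd h Bool.false_ne_true) hpcs hU
  have hpubs : (P.pubs f N [] false [] pcs).length = P.kk N * pubLen N := length_pubs hlp (τ := []) (by simp) (fun h => absurd h Bool.false_ne_true) hpcs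
  have hh : (hashStr (P.kk N * kL N) (P.mlen N (tStar f N)) U (P.blocks N [] false [] pcs)).length = P.mlen N (tStar f N) := length_hashStr _ _ _ _
  simp only [phiStr, ht]
  rw [List.take_append_of_le_length hD.ge, List.take_of_length_le hD.le, List.drop_append_of_le_length hD.ge, List.drop_of_length_le hD.le,
    List.nil_append]
  have e1 : (P.Dsample f N (tStar f N) [] false [] pcs U).take (P.mlen N (tStar f N)) = hashStr (P.kk N * kL N) (P.mlen N (tStar f N)) U (P.blocks N [] false [] pcs) := by
    rw [Dsample, List.append_assoc, List.take_append_of_le_length hh.ge, List.take_of_length_le hh.le]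
  have e2 : ((P.Dsample f N (tStar f N) [] false [] pcs U).drop (P.mlen N (tStar f N))).take (P.kk N * pubLen N) = P.pubs f N [] false [] pcs := by
    rw [Dsample, List.append_assoc, List.drop_append_of_le_length hh.ge, List.drop_of_length_le hh.le, List.nil_append,
      List.take_append_of_le_length hpubs.ge, List.take_of_length_le hpubs.le]
  have e3 : (P.Dsample f N (tStar f N) [] false [] pcs U).drop (P.mlen N (tStar f N) + P.kk N * pubLen N) = U := by
    rw [Dsample, List.drop_append_of_le_length (by rw [List.length_append, hh, hpubs]), List.drop_of_length_le (by rw [List.length_append, hh, hpubs]),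
      List.nil_append]
  have e4 : (Z1 ++ U1 ++ U3).take (P.m1 N a) = Z1 := by
    rw [List.append_assoc, List.take_append_of_le_length hZ1.ge, List.take_of_length_le hZ1.le]
  have e5 : ((Z1 ++ U1 ++ U3).drop (P.m1 N a)).take (P.key1 N a) = U1 := by
    rw [List.append_assoc, List.drop_append_of_le_length hZ1.ge, List.drop_of_length_le hZ1.le, List.nil_append,
      List.take_append_of_le_length hU1.ge, List.take_of_length_le hU1.le]
  have e6 : (Z1 ++ U1 ++ U3).drop (P.m1 N a + P.key1 N a) = U3 := by
    rw [List.drop_append_of_le_length (by rw [List.length_append, hZ1, hU1]), List.drop_of_length_le (by rw [List.length_append, hZ1, hU1]), List.nil_append]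
  rw [e1, e2, e3, e4, e5, e6, fOfPubs_pubs hlp hpcs, yOfPubs_pubs hlp hpcs]

/-- **The per-`pcs` integrand of the `H₁` side in block form.** [folklore] -/
theorem inner1'_eq (D : RandAlg (List Bool) Bool) {N a : ℕ} (ht : tOfA N a = tStar f N) (U1 : List.Vector Bool (P.key1 N a)) (ω : Fin (P.kk N) → PC N) :
    (uniformAvg (P.m1 N a) fun Z1 => uniformAvg (P.uLen N (tStar f N)) fun U => uniformAvg (P.key3 N a) fun U3 =>
      pD D N (lay U3 (List.ofFn fun i : Fin (P.kk N) => pcS N (ω i).toList).flatten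
        (hashStr (P.fLen N) (P.m3 N a) U3 (List.ofFn fun i : Fin (P.kk N) => g f (pcW N (ω i).toList ++ pcR N (ω i).toList)).flatten) U
        (hashStr (P.kk N * kL N) (P.mlen N (tStar f N)) U (List.ofFn fun i : Fin (P.kk N) => glBits (kL N) N (pcW N (ω i).toList) (pcS N (ω i).toList)).flatten) Z1 U1.toList)) =
      (∑ u : Fin (P.m1 N a) → ZMod 2, P.F1 D N a (Extract.ztup (y1 f N) ω) (U1, u)) / 2 ^ P.m1 N a := by
  set G : List Bool → ℝ := fun Z1 => uniformAvg (P.uLen N (tStar f N)) fun U => uniformAvg (P.key3 N a) fun U3 =>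
      pD D N (lay U3 (List.ofFn fun i : Fin (P.kk N) => pcS N (ω i).toList).flatten
        (hashStr (P.fLen N) (P.m3 N a) U3 (List.ofFn fun i : Fin (P.kk N) => g f (pcW N (ω i).toList ++ pcR N (ω i).toList)).flatten) U
        (hashStr (P.kk N * kL N) (P.mlen N (tStar f N)) U (List.ofFn fun i : Fin (P.kk N) => glBits (kL N) N (pcW N (ω i).toList) (pcS N (ω i).toList)).flatten) Z1 U1.toList) with hG
  show (∑ x : List.Vector Bool (P.m1 N a), G x.toList) / 2 ^ P.m1 N a = _
  rw [← sum_encZ_eq_sum_vector]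
  congr 1
  refine Finset.sum_congr rfl fun u _ => ?_
  simp only [hG, F1, assemble1, m2, ht]
  rfl

/-- **`Pr[D(H₁) = 1]` as the ideal-side average of the extraction lemma.** [cite: HastadImpagliazzoLevinLuby1999, Thm 7.0.5 (proof, step (1))] -/
theorem prX1_eq (hlp : IsLengthPreserving f) (D : RandAlg (List Bool) Bool) {N a : ℕ} (ht : tOfA N a = tStar f N) {ΦF : List Bool → List Bool}
    (hΦv : ∀ β : List Bool, β.length = P.sLen N (tStar f N) + P.rLen N a → ΦF (boolPair (unaryEncodeNat N) (boolPair (ones a) β)) = P.phiStr N a β) :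
    (acceptPMF D N (((P.Dens f N).bind fun α => (uniformBits (P.rLen N a)).map fun R => α ++ R).map fun β =>
        ΦF (boolPair (unaryEncodeNat N) (boolPair (ones a) β))) true).toReal =
      (∑ U1 : List.Vector Bool (P.key1 N a), ∑ ω : Fin (P.kk N) → PC N, ∑ u : Fin (P.m1 N a) → ZMod 2,
        P.F1 D N a (Extract.ztup (y1 f N) ω) (U1, u)) / (2 ^ P.key1 N a * 2 ^ P.Lp N * 2 ^ P.m1 N a) := by
  rw [Dens, bind_append_uniform_eq_map, PMF.map_comp, acceptPMF_map_uniformBits_toReal]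
  unfold rLen
  simp only [uniformAvg_append, Function.comp_apply]
  -- the integrand
  set B : List Bool → List Bool → List Bool → List Bool → List Bool → ℝ := fun pcs U Z1 U1 U3 =>
    pD D N (lay U3 (P.yprimes N pcs) (hashStr (P.fLen N) (P.m3 N a) U3 (P.fprimes f N pcs)) U
      (hashStr (P.kk N * kL N) (P.mlen N (tStar f N)) U (P.blocks N [] false [] pcs)) Z1 U1) with hB
  have hint : ∀ pcs U Z1 U1 U3 : List Bool, pcs.length = P.kk N * cP N → U.length = P.uLen N (tStar f N) → Z1.length = P.m1 N a → U1.length = P.key1 N a →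
      U3.length = P.key3 N a →
      (D.outputPMF id (boolPair (unaryEncodeNat N) (ΦF (boolPair (unaryEncodeNat N) (boolPair (ones a)
        (P.Dsample f N (tStar f N) [] false []
          (List.take (P.kk N * cP N) (List.take (P.kk N * cP N + P.uLen N (tStar f N)) (pcs ++ U ++ (Z1 ++ U1 ++ U3))))
          (List.drop (P.kk N * cP N) (List.take (P.kk N * cP N + P.uLen N (tStar f N)) (pcs ++ U ++ (Z1 ++ U1 ++ U3)))) ++
          List.drop (P.kk N * cP N + P.uLen N (tStar f N)) (pcs ++ U ++ (Z1 ++ U1 ++ U3))))))) true).toReal = B pcs U Z1 U1 U3 := by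
    intro pcs U Z1 U1 U3 hpcs hU hZ1 hU1 hU3
    have hL : (pcs ++ U).length = P.kk N * cP N + P.uLen N (tStar f N) := by rw [List.length_append, hpcs, hU]
    rw [List.take_append_of_le_length hL.ge, List.take_of_length_le hL.le, List.drop_append_of_le_length hL.ge,
      List.drop_of_length_le hL.le, List.nil_append, List.take_append_of_le_length hpcs.ge, List.take_of_length_le hpcs.le,
      List.drop_append_of_le_length hpcs.ge, List.drop_of_length_le hpcs.le, List.nil_append,
      hΦv _ (by rw [List.length_append, List.length_append, List.length_append, length_Dsample hlp (τ := []) (by simp) (fun h => absurd h Bool.false_ne_true) hpcs hU,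
        hZ1, hU1, hU3, rLen]), phiStr_Dsample hlp ht hpcs hU hZ1 hU1]
    rfl
  rw [uniformAvg_congr fun pcs hpcs => uniformAvg_congr fun U hU => uniformAvg_congr fun Z1 hZ1 => uniformAvg_congr fun U1 hU1 => uniformAvg_congr fun U3 hU3 =>
    hint pcs U Z1 U1 U3 hpcs hU hZ1 hU1 hU3]
  -- reorder to `U₁, pcs, Z₁, U, U₃`
  have s1 : (uniformAvg (P.kk N * cP N) fun pcs => uniformAvg (P.uLen N (tStar f N)) fun U => uniformAvg (P.m1 N a) fun Z1 =>
      uniformAvg (P.key1 N a) fun U1 => uniformAvg (P.key3 N a) fun U3 => B pcs U Z1 U1 U3) =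
      uniformAvg (P.key1 N a) fun U1 => uniformAvg (P.kk N * cP N) fun pcs => uniformAvg (P.m1 N a) fun Z1 =>
        uniformAvg (P.uLen N (tStar f N)) fun U => uniformAvg (P.key3 N a) fun U3 => B pcs U Z1 U1 U3 := by
    -- `U ↔ Z₁`, then `U ↔ U₁`, then `Z₁ ↔ U₁`, then `pcs ↔ U₁`
    rw [uniformAvg_congr fun pcs _ => uniformAvg_comm (P.uLen N (tStar f N)) (P.m1 N a) (fun U Z1 =>
      uniformAvg (P.key1 N a) fun U1 => uniformAvg (P.key3 N a) fun U3 => B pcs U Z1 U1 U3)]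
    rw [uniformAvg_congr fun pcs _ => uniformAvg_congr fun Z1 _ => uniformAvg_comm (P.uLen N (tStar f N)) (P.key1 N a) (fun U U1 =>
      uniformAvg (P.key3 N a) fun U3 => B pcs U Z1 U1 U3)]
    rw [uniformAvg_congr fun pcs _ => uniformAvg_comm (P.m1 N a) (P.key1 N a) (fun Z1 U1 =>
      uniformAvg (P.uLen N (tStar f N)) fun U => uniformAvg (P.key3 N a) fun U3 => B pcs U Z1 U1 U3)]
    exact uniformAvg_comm (P.kk N * cP N) (P.key1 N a) (fun pcs U1 => uniformAvg (P.m1 N a) fun Z1 =>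
      uniformAvg (P.uLen N (tStar f N)) fun U => uniformAvg (P.key3 N a) fun U3 => B pcs U Z1 U1 U3)
  rw [s1]
  -- block form
  have hblk : ∀ U1 : List Bool, (uniformAvg (P.kk N * cP N) fun pcs => uniformAvg (P.m1 N a) fun Z1 =>
      uniformAvg (P.uLen N (tStar f N)) fun U => uniformAvg (P.key3 N a) fun U3 => B pcs U Z1 U1 U3) =
      (∑ ω : Fin (P.kk N) → PC N, uniformAvg (P.m1 N a) fun Z1 => uniformAvg (P.uLen N (tStar f N)) fun U => uniformAvg (P.key3 N a) fun U3 =>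
        pD D N (lay U3 (List.ofFn fun i : Fin (P.kk N) => pcS N (ω i).toList).flatten
          (hashStr (P.fLen N) (P.m3 N a) U3 (List.ofFn fun i : Fin (P.kk N) => g f (pcW N (ω i).toList ++ pcR N (ω i).toList)).flatten) U
          (hashStr (P.kk N * kL N) (P.mlen N (tStar f N)) U (List.ofFn fun i : Fin (P.kk N) => glBits (kL N) N (pcW N (ω i).toList) (pcS N (ω i).toList)).flatten) Z1 U1)) / 2 ^ (P.kk N * cP N) := by
    intro U1
    have h := GAvg.uniformAvg_blocks (P.kk N) (cP N) (fun bl => uniformAvg (P.m1 N a) fun Z1 => uniformAvg (P.uLen N (tStar f N)) fun U =>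
      uniformAvg (P.key3 N a) fun U3 =>
        pD D N (lay U3 (List.ofFn fun i : Fin (P.kk N) => pcS N (bl i)).flatten
          (hashStr (P.fLen N) (P.m3 N a) U3 (List.ofFn fun i : Fin (P.kk N) => g f (pcW N (bl i) ++ pcR N (bl i))).flatten) U
          (hashStr (P.kk N * kL N) (P.mlen N (tStar f N)) U (List.ofFn fun i : Fin (P.kk N) => glBits (kL N) N (pcW N (bl i)) (pcS N (bl i))).flatten) Z1 U1))
    dsimp only at h
    rw [← h]
    refine uniformAvg_congr fun pcs _ => ?_
    simp only [hB, ← blocks_nil_eq, ← fprimes_eq, ← yprimes_eq]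
  rw [uniformAvg]
  simp only [hblk, inner1'_eq D ht]
  rw [Finset.sum_div]
  conv_rhs => rw [Finset.sum_div]
  refine Finset.sum_congr rfl fun U1 _ => ?_
  rw [Finset.sum_div, Finset.sum_div]
  conv_rhs => rw [Finset.sum_div]
  refine Finset.sum_congr rfl fun ω _ => ?_
  rw [div_div, div_div]
  congr 1
  show (2 : ℝ) ^ P.m1 N a * (2 ^ (P.kk N * cP N) * 2 ^ P.key1 N a) = 2 ^ P.key1 N a * 2 ^ (P.kk N * cP N) * 2 ^ P.m1 N a
  ring

/-- **Step (1) of the proof of Theorem 7.0.5, quantitatively**: for every `D`,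
`|Pr[D(H₀)=1] − Pr[D(H₁)=1]| ≤ 2e^{−2kη²} + ½ √(2^{m₁}·2^{1−kmin₁})`,
`kmin₁ = k·H(pc | f', σ, GL) − kη·cP`. [cite: HastadImpagliazzoLevinLuby1999, Thm 7.0.5 (proof, step (1), via Cor. 4.5.3)] -/
theorem abs_prX0_sub_prX1_le (hlp : IsLengthPreserving f) (D : RandAlg (List Bool) Bool) {N a : ℕ} (ht : tOfA N a = tStar f N)
    {ΦF : List Bool → List Bool}
    (hΦv : ∀ β : List Bool, β.length = P.sLen N (tStar f N) + P.rLen N a → ΦF (boolPair (unaryEncodeNat N) (boolPair (ones a) β)) = P.phiStr N a β)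
    (hk : 0 < P.kk N) {η : ℝ} (hη : 0 ≤ η) (hε : 2 * Real.exp (-2 * P.kk N * η ^ 2) ≤ 1) :
    |(acceptPMF D N ((uniformBits (P.coreLen N a)).map (P.coreOut f N a)) true).toReal -
        (acceptPMF D N (((P.Dens f N).bind fun α => (uniformBits (P.rLen N a)).map fun R => α ++ R).map fun β =>
          ΦF (boolPair (unaryEncodeNat N) (boolPair (ones a) β))) true).toReal| ≤
      2 * Real.exp (-2 * P.kk N * η ^ 2) + 2⁻¹ * Real.sqrt (2 ^ P.m1 N a * (2 * (2 : ℝ) ^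
        (-(P.kk N * (mapEntropy Finset.univ (fun pc : PC N => (pc, y1 f N pc)) - mapEntropy Finset.univ (y1 f N)) - P.kk N * η * cP N)))) := by
  classical
  have hPC : 1 < Fintype.card (PC N) := by
    rw [card_vector, Fintype.card_bool]
    have : 1 ≤ cP N := by unfold cP rlen; nlinarith
    calc 1 < 2 ^ 1 := by norm_num
      _ ≤ 2 ^ cP N := Nat.pow_le_pow_right (by norm_num) this
  have hkey : P.m1 N a * (P.kk N * cP N + 1) ≤ P.key1 N a := by unfold key1 Lp; exact le_rfl
  have h := Extract.extract_cond_test_smooth (x := fun pc : PC N => pc) (y := y1 f N) hk hη hPC hkey hε (P.F1 D N a)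
    (fun cv p => (F1_mem D N a cv p).1) (fun cv p => (F1_mem D N a cv p).2)
  rw [prX0_eq, prX1_eq hlp D ht hΦv]
  have hc1 : ((Finset.univ : Finset (List.Vector Bool (P.key1 N a))).card : ℝ) = 2 ^ P.key1 N a := by
    rw [Finset.card_univ, card_vector, Fintype.card_bool]; push_cast; ring
  have hc2 : ((Finset.univ : Finset (Fin (P.kk N) → PC N)).card : ℝ) = 2 ^ P.Lp N := by
    rw [Finset.card_univ, Fintype.card_fun, Fintype.card_fin, card_vector, Fintype.card_bool, Lp, ← pow_mul, mul_comm]; push_cast; ring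
  have hc3 : (Fintype.card (Fin (P.m1 N a) → ZMod 2) : ℝ) = 2 ^ P.m1 N a := by
    rw [Fintype.card_fun, Fintype.card_fin, ZMod.card]; push_cast; ring
  have hlog : Real.logb 2 (Fintype.card (PC N)) = cP N := by
    rw [card_vector, Fintype.card_bool]; push_cast; rw [Real.logb_pow, Real.logb_self_eq_one one_lt_two, mul_one]
  rw [hc1, hc2, hc3, hlog] at h
  exact h

/-! ### Step (3): the acceptance probabilities as the averages of `extract_cond_test_smooth` -/

/-- The first block of an appended block string. [folklore] -/
theorem blkL_zero_append {m : ℕ} {pc rest : List Bool} (hpc : pc.length = m) : Greedy.blkL m 0 (pc ++ rest) = pc := by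
  rw [Greedy.blkL, Nat.zero_mul, List.drop_zero, List.take_append_of_le_length hpc.ge, List.take_of_length_le hpc.le]

/-- Later blocks of an appended block string. [folklore] -/
theorem blkL_succ_append {m : ℕ} {pc rest : List Bool} (hpc : pc.length = m) (i : ℕ) : Greedy.blkL m (i + 1) (pc ++ rest) = Greedy.blkL m i rest := by
  rw [Greedy.blkL, Greedy.blkL, Nat.succ_mul, Nat.add_comm, ← List.drop_drop, List.drop_append_of_le_length hpc.ge, List.drop_of_length_le hpc.le,
    List.nil_append]

/-- Averaging a function of the `σ`-window of a position block is averaging over `σ`. [folklore] -/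
theorem uniformAvg_pcS (N : ℕ) (h : List Bool → ℝ) : uniformAvg (cP N) (fun pc => h (pcS N pc)) = uniformAvg (kL N * N) h := by
  have e : cP N = (N + rlen N) + (kL N * N + kL N) := by unfold cP; ring
  rw [e, uniformAvg_append]
  rw [uniformAvg_congr fun a ha => show (uniformAvg (kL N * N + kL N) fun w => h (pcS N (a ++ w))) = uniformAvg (kL N * N + kL N) fun w => h (w.take (kL N * N)) from
    uniformAvg_congr fun w _ => by rw [pcS, List.drop_append_of_le_length ha.ge, List.drop_of_length_le ha.le, List.nil_append], uniformAvg_const,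
    uniformAvg_append]
  exact uniformAvg_congr fun σ hσ => by
    rw [uniformAvg_congr fun u _ => show h ((σ ++ u).take (kL N * N)) = h σ by rw [List.take_append_of_le_length hσ.ge, List.take_of_length_le hσ.le],
      uniformAvg_const]

/-- **Projection**: averaging over the position coins a function of the `σ`-windows only is averaging over `Y'`. [folklore] -/
theorem uniformAvg_proj_pcS (N : ℕ) : ∀ (k : ℕ) (G : List Bool → ℝ),
    uniformAvg (k * cP N) (fun pcs => G (List.ofFn fun i : Fin k => pcS N (Greedy.blkL (cP N) i pcs)).flatten) = uniformAvg (k * (kL N * N)) G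
  | 0, G => by
    simp only [Nat.zero_mul]
    exact uniformAvg_congr fun x hx => by rw [List.length_eq_zero_iff.1 hx, List.ofFn_zero, List.flatten_nil]
  | k + 1, G => by
    have e1 : (k + 1) * cP N = cP N + k * cP N := by ring
    have e2 : (k + 1) * (kL N * N) = kL N * N + k * (kL N * N) := by ring
    rw [e1, e2, uniformAvg_append, uniformAvg_append]
    rw [uniformAvg_congr fun pc hpc => show (uniformAvg (k * cP N) fun rest => G (List.ofFn fun i : Fin (k + 1) => pcS N (Greedy.blkL (cP N) i (pc ++ rest))).flatten) =
        uniformAvg (k * (kL N * N)) fun Y => G (pcS N pc ++ Y) from by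
      rw [← uniformAvg_proj_pcS N k (fun Y => G (pcS N pc ++ Y))]
      refine uniformAvg_congr fun rest _ => ?_
      rw [List.ofFn_succ, List.flatten_cons, Fin.val_zero, blkL_zero_append hpc,
        show (fun i : Fin k => pcS N (Greedy.blkL (cP N) (i.succ : ℕ) (pc ++ rest))) = fun i : Fin k => pcS N (Greedy.blkL (cP N) i rest) from
          funext fun i => by rw [Fin.val_succ, blkL_succ_append hpc]]]
    exact uniformAvg_pcS N (fun σ => uniformAvg (k * (kL N * N)) fun Y => G (σ ++ Y))

variable (P f)

/-- **The test of step (3)**: average acceptance over `U, Z₂, Z₁, U₁`, given the side tuple `(σ_j)_j`, the key `U₃`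
and a candidate value of `h₃`. [cite: HastadImpagliazzoLevinLuby1999, Thm 7.0.5 (proof, step (3))] -/
noncomputable def F3 (D : RandAlg (List Bool) Bool) (N a : ℕ) (z : Fin (P.kk N) → SG N)
    (p : List.Vector Bool (P.key3 N a) × (Fin (P.m3 N a) → ZMod 2)) : ℝ :=
  uniformAvg (P.uLen N (tOfA N a)) fun U => uniformAvg (P.m2 N a) fun Z2 => uniformAvg (P.m1 N a) fun Z1 => uniformAvg (P.key1 N a) fun U1 =>
    pD D N (lay p.1.toList (List.ofFn fun i => (z i).toList).flatten (encZ (P.m3 N a) p.2) U Z2 Z1 U1)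

variable {P f}

/-- `0 ≤ F3 ≤ 1`. [folklore] -/
theorem F3_mem (D : RandAlg (List Bool) Bool) (N a : ℕ) (z : Fin (P.kk N) → SG N) (p : List.Vector Bool (P.key3 N a) × (Fin (P.m3 N a) → ZMod 2)) :
    0 ≤ P.F3 D N a z p ∧ P.F3 D N a z p ≤ 1 :=
  ⟨uniformAvg_nonneg fun _ => uniformAvg_nonneg fun _ => uniformAvg_nonneg fun _ => uniformAvg_nonneg fun _ => (pD_mem D N _).1,
    uniformAvg_le_one fun _ => uniformAvg_le_one fun _ => uniformAvg_le_one fun _ => uniformAvg_le_one fun _ => (pD_mem D N _).2⟩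

/-- **`Pr[D(H₃) = 1]` as the ideal-side average of the extraction lemma (step (3)).** [cite: HastadImpagliazzoLevinLuby1999, Thm 7.0.5 (proof, step (3))] -/
theorem prX3_eq (D : RandAlg (List Bool) Bool) (N a : ℕ) :
    (acceptPMF D N (uniformBits (P.outLen N a)) true).toReal =
      (∑ U3 : List.Vector Bool (P.key3 N a), ∑ ω : Fin (P.kk N) → PC N, ∑ u : Fin (P.m3 N a) → ZMod 2,
        P.F3 D N a (Extract.ztup (y3 N) ω) (U3, u)) / (2 ^ P.key3 N a * 2 ^ P.Lp N * 2 ^ P.m3 N a) := by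
  rw [acceptPMF, bind_uniformBits_apply_toReal]
  unfold outLen yLen
  simp only [uniformAvg_append]
  -- the `Y`-average as an average over position coins, in block form
  have hY : ∀ U3 : List Bool, (uniformAvg (P.kk N * (kL N * N)) fun Y => uniformAvg (P.m3 N a) fun Z3 => uniformAvg (P.uLen N (tOfA N a)) fun U =>
      uniformAvg (P.m2 N a) fun Z2 => uniformAvg (P.m1 N a) fun Z1 => uniformAvg (P.key1 N a) fun U1 => (D.outputPMF id (boolPair (unaryEncodeNat N) (U3 ++ Y ++ Z3 ++ U ++ Z2 ++ Z1 ++ U1)) true).toReal) =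
      (∑ ω : Fin (P.kk N) → PC N, uniformAvg (P.m3 N a) fun Z3 => uniformAvg (P.uLen N (tOfA N a)) fun U =>
        uniformAvg (P.m2 N a) fun Z2 => uniformAvg (P.m1 N a) fun Z1 => uniformAvg (P.key1 N a) fun U1 =>
          (D.outputPMF id (boolPair (unaryEncodeNat N) (U3 ++ (List.ofFn fun i : Fin (P.kk N) => pcS N (ω i).toList).flatten ++ Z3 ++ U ++ Z2 ++ Z1 ++ U1)) true).toReal) / 2 ^ (P.kk N * cP N) := by
    intro U3
    rw [← uniformAvg_proj_pcS N (P.kk N) (fun Y => uniformAvg (P.m3 N a) fun Z3 => uniformAvg (P.uLen N (tOfA N a)) fun U =>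
      uniformAvg (P.m2 N a) fun Z2 => uniformAvg (P.m1 N a) fun Z1 => uniformAvg (P.key1 N a) fun U1 => (D.outputPMF id (boolPair (unaryEncodeNat N) (U3 ++ Y ++ Z3 ++ U ++ Z2 ++ Z1 ++ U1)) true).toReal)]
    have h := GAvg.uniformAvg_blocks (P.kk N) (cP N) (fun bl => uniformAvg (P.m3 N a) fun Z3 => uniformAvg (P.uLen N (tOfA N a)) fun U =>
      uniformAvg (P.m2 N a) fun Z2 => uniformAvg (P.m1 N a) fun Z1 => uniformAvg (P.key1 N a) fun U1 =>
        (D.outputPMF id (boolPair (unaryEncodeNat N) (U3 ++ (List.ofFn fun i : Fin (P.kk N) => pcS N (bl i)).flatten ++ Z3 ++ U ++ Z2 ++ Z1 ++ U1)) true).toReal)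
    dsimp only at h
    rw [← h]
  -- the `Z₃`-average as a sum over `𝔽₂^{m₃}`
  have hZ : ∀ (U3 : List.Vector Bool (P.key3 N a)) (ω : Fin (P.kk N) → PC N), (uniformAvg (P.m3 N a) fun Z3 => uniformAvg (P.uLen N (tOfA N a)) fun U =>
      uniformAvg (P.m2 N a) fun Z2 => uniformAvg (P.m1 N a) fun Z1 => uniformAvg (P.key1 N a) fun U1 =>
        (D.outputPMF id (boolPair (unaryEncodeNat N) (U3.toList ++ (List.ofFn fun i : Fin (P.kk N) => pcS N (ω i).toList).flatten ++ Z3 ++ U ++ Z2 ++ Z1 ++ U1)) true).toReal) =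
      (∑ u : Fin (P.m3 N a) → ZMod 2, P.F3 D N a (Extract.ztup (y3 N) ω) (U3, u)) / 2 ^ P.m3 N a := by
    intro U3 ω
    set G : List Bool → ℝ := fun Z3 => uniformAvg (P.uLen N (tOfA N a)) fun U => uniformAvg (P.m2 N a) fun Z2 => uniformAvg (P.m1 N a) fun Z1 =>
      uniformAvg (P.key1 N a) fun U1 => (D.outputPMF id (boolPair (unaryEncodeNat N) (U3.toList ++ (List.ofFn fun i : Fin (P.kk N) => pcS N (ω i).toList).flatten ++ Z3 ++ U ++ Z2 ++ Z1 ++ U1)) true).toReal with hG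
    show (∑ x : List.Vector Bool (P.m3 N a), G x.toList) / 2 ^ P.m3 N a = _
    rw [← sum_encZ_eq_sum_vector]
    rfl
  rw [uniformAvg]
  simp only [hY, hZ]
  rw [Finset.sum_div]
  conv_rhs => rw [Finset.sum_div]
  refine Finset.sum_congr rfl fun U3 _ => ?_
  rw [Finset.sum_div, Finset.sum_div]
  conv_rhs => rw [Finset.sum_div]
  refine Finset.sum_congr rfl fun ω _ => ?_
  rw [div_div, div_div]
  congr 1
  show (2 : ℝ) ^ P.m3 N a * (2 ^ (P.kk N * cP N) * 2 ^ P.key3 N a) = 2 ^ P.key3 N a * 2 ^ (P.kk N * cP N) * 2 ^ P.m3 N a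
  ring

/-- **Value of the simulator on `ℰ`-sample ‖ R`** (correct density advice). [folklore] -/
theorem phiStr_Esample (hlp : IsLengthPreserving f) {N a : ℕ} (ht : tOfA N a = tStar f N) {pcs U Z2 Z1 U1 U3 : List Bool}
    (hpcs : pcs.length = P.Lp N) (hU : U.length = P.uLen N (tStar f N)) (hZ2 : Z2.length = P.mlen N (tStar f N)) (hZ1 : Z1.length = P.m1 N a)
    (hU1 : U1.length = P.key1 N a) :
    P.phiStr N a (P.Esample f N [] false [] pcs U Z2 ++ (Z1 ++ U1 ++ U3)) =
      lay U3 (P.yprimes N pcs) (hashStr (P.fLen N) (P.m3 N a) U3 (P.fprimes f N pcs)) U Z2 Z1 U1 := by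
  have hE : (P.Esample f N [] false [] pcs U Z2).length = P.sLen N (tStar f N) :=
    length_Esample hlp (τ := []) (by simp) (fun h => absurd h Bool.false_ne_true) hpcs hU hZ2
  have hpubs : (P.pubs f N [] false [] pcs).length = P.kk N * pubLen N := length_pubs hlp (τ := []) (by simp) (fun h => absurd h Bool.false_ne_true) hpcs
  simp only [phiStr, ht]
  rw [List.take_append_of_le_length hE.ge, List.take_of_length_le hE.le, List.drop_append_of_le_length hE.ge, List.drop_of_length_le hE.le,
    List.nil_append]
  have e1 : (P.Esample f N [] false [] pcs U Z2).take (P.mlen N (tStar f N)) = Z2 := by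
    rw [Esample, List.append_assoc, List.take_append_of_le_length hZ2.ge, List.take_of_length_le hZ2.le]
  have e2 : ((P.Esample f N [] false [] pcs U Z2).drop (P.mlen N (tStar f N))).take (P.kk N * pubLen N) = P.pubs f N [] false [] pcs := by
    rw [Esample, List.append_assoc, List.drop_append_of_le_length hZ2.ge, List.drop_of_length_le hZ2.le, List.nil_append,
      List.take_append_of_le_length hpubs.ge, List.take_of_length_le hpubs.le]
  have e3 : (P.Esample f N [] false [] pcs U Z2).drop (P.mlen N (tStar f N) + P.kk N * pubLen N) = U := by
    rw [Esample, List.drop_append_of_le_length (by rw [List.length_append, hZ2, hpubs]), List.drop_of_length_le (by rw [List.length_append, hZ2, hpubs]),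
      List.nil_append]
  have e4 : (Z1 ++ U1 ++ U3).take (P.m1 N a) = Z1 := by
    rw [List.append_assoc, List.take_append_of_le_length hZ1.ge, List.take_of_length_le hZ1.le]
  have e5 : ((Z1 ++ U1 ++ U3).drop (P.m1 N a)).take (P.key1 N a) = U1 := by
    rw [List.append_assoc, List.drop_append_of_le_length hZ1.ge, List.drop_of_length_le hZ1.le, List.nil_append,
      List.take_append_of_le_length hU1.ge, List.take_of_length_le hU1.le]
  have e6 : (Z1 ++ U1 ++ U3).drop (P.m1 N a + P.key1 N a) = U3 := by
    rw [List.drop_append_of_le_length (by rw [List.length_append, hZ1, hU1]), List.drop_of_length_le (by rw [List.length_append, hZ1, hU1]), List.nil_append]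
  rw [e1, e2, e3, e4, e5, e6, fOfPubs_pubs hlp hpcs, yOfPubs_pubs hlp hpcs]

/-- The hash input of step (3) is `F'`. [folklore] -/
theorem toList_xvec_x3 (hlp : IsLengthPreserving f) {N : ℕ} (ω : Fin (P.kk N) → PC N) :
    (Extract.xvec (x3 f N) ω).toList = (List.ofFn fun i : Fin (P.kk N) => g f (pcW N (ω i).toList ++ pcR N (ω i).toList)).flatten := by
  rw [Extract.xvec, toList_tupleVecEquiv]
  congr 1
  refine congrArg List.ofFn (funext fun i => ?_)
  show gFix N (Ent.fvalV f N (pcSplit N (ω i)).1.1) = _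
  exact gFix_eq (length_g hlp (pcSplit N (ω i)).1.1.1.toList_length (pcSplit N (ω i)).1.1.2.toList_length)

/-- **The per-`pcs` integrand of the `H₂` side in block form.** [folklore] -/
theorem inner3_eq (hlp : IsLengthPreserving f) (D : RandAlg (List Bool) Bool) {N a : ℕ} (ht : tOfA N a = tStar f N) (U3 : List.Vector Bool (P.key3 N a))
    (ω : Fin (P.kk N) → PC N) :
    (uniformAvg (P.uLen N (tStar f N)) fun U => uniformAvg (P.mlen N (tStar f N)) fun Z2 => uniformAvg (P.m1 N a) fun Z1 => uniformAvg (P.key1 N a) fun U1 =>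
      pD D N (lay U3.toList (List.ofFn fun i : Fin (P.kk N) => pcS N (ω i).toList).flatten
        (hashStr (P.fLen N) (P.m3 N a) U3.toList (List.ofFn fun i : Fin (P.kk N) => g f (pcW N (ω i).toList ++ pcR N (ω i).toList)).flatten) U Z2 Z1 U1)) =
      P.F3 D N a (Extract.ztup (y3 N) ω) (U3, hashV (P.kk N * Lg N) (P.m3 N a) U3.toList (Extract.xvec (x3 f N) ω)) := by
  have hh : hashStr (P.fLen N) (P.m3 N a) U3.toList (List.ofFn fun i : Fin (P.kk N) => g f (pcW N (ω i).toList ++ pcR N (ω i).toList)).flatten =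
      encZ (P.m3 N a) (hashV (P.kk N * Lg N) (P.m3 N a) U3.toList (Extract.xvec (x3 f N) ω)) := by
    rw [← toList_xvec_x3 hlp, fLen, hashStr_toList]
  rw [hh]
  simp only [F3, m2, ht]
  rfl

/-- **`Pr[D(H₂) = 1]` as the real-side average of the extraction lemma (step (3)).** [cite: HastadImpagliazzoLevinLuby1999, Thm 7.0.5 (proof, step (3))] -/
theorem prX2_eq (hlp : IsLengthPreserving f) (D : RandAlg (List Bool) Bool) {N a : ℕ} (ht : tOfA N a = tStar f N) {ΦF : List Bool → List Bool}
    (hΦv : ∀ β : List Bool, β.length = P.sLen N (tStar f N) + P.rLen N a → ΦF (boolPair (unaryEncodeNat N) (boolPair (ones a) β)) = P.phiStr N a β) :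
    (acceptPMF D N (((P.Eens f N).bind fun α => (uniformBits (P.rLen N a)).map fun R => α ++ R).map fun β =>
        ΦF (boolPair (unaryEncodeNat N) (boolPair (ones a) β))) true).toReal =
      (∑ U3 : List.Vector Bool (P.key3 N a), ∑ ω : Fin (P.kk N) → PC N,
        P.F3 D N a (Extract.ztup (y3 N) ω) (U3, hashV (P.kk N * Lg N) (P.m3 N a) U3.toList (Extract.xvec (x3 f N) ω))) /
        (2 ^ P.key3 N a * 2 ^ P.Lp N) := by
  rw [Eens, bind_append_uniform_eq_map, PMF.map_comp, acceptPMF_map_uniformBits_toReal]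
  unfold rLen
  simp only [uniformAvg_append, Function.comp_apply]
  set B : List Bool → List Bool → List Bool → List Bool → List Bool → List Bool → ℝ := fun pcs U Z2 Z1 U1 U3 =>
    pD D N (lay U3 (P.yprimes N pcs) (hashStr (P.fLen N) (P.m3 N a) U3 (P.fprimes f N pcs)) U Z2 Z1 U1) with hB
  have hint : ∀ pcs U Z2 Z1 U1 U3 : List Bool, pcs.length = P.kk N * cP N → U.length = P.uLen N (tStar f N) → Z2.length = P.mlen N (tStar f N) →
      Z1.length = P.m1 N a → U1.length = P.key1 N a → U3.length = P.key3 N a →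
      (D.outputPMF id (boolPair (unaryEncodeNat N) (ΦF (boolPair (unaryEncodeNat N) (boolPair (ones a)
        (P.Esample f N [] false []
          (List.take (P.kk N * cP N) (List.take (P.kk N * cP N + P.uLen N (tStar f N) + P.mlen N (tStar f N)) (pcs ++ U ++ Z2 ++ (Z1 ++ U1 ++ U3))))
          (List.take (P.uLen N (tStar f N)) (List.drop (P.kk N * cP N) (List.take (P.kk N * cP N + P.uLen N (tStar f N) + P.mlen N (tStar f N)) (pcs ++ U ++ Z2 ++ (Z1 ++ U1 ++ U3)))))
          (List.drop (P.kk N * cP N + P.uLen N (tStar f N)) (List.take (P.kk N * cP N + P.uLen N (tStar f N) + P.mlen N (tStar f N)) (pcs ++ U ++ Z2 ++ (Z1 ++ U1 ++ U3)))) ++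
          List.drop (P.kk N * cP N + P.uLen N (tStar f N) + P.mlen N (tStar f N)) (pcs ++ U ++ Z2 ++ (Z1 ++ U1 ++ U3))))))) true).toReal = B pcs U Z2 Z1 U1 U3 := by
    intro pcs U Z2 Z1 U1 U3 hpcs hU hZ2 hZ1 hU1 hU3
    have hL : (pcs ++ U ++ Z2).length = P.kk N * cP N + P.uLen N (tStar f N) + P.mlen N (tStar f N) := by
      rw [List.length_append, List.length_append, hpcs, hU, hZ2]
    have hL2 : (pcs ++ U).length = P.kk N * cP N + P.uLen N (tStar f N) := by rw [List.length_append, hpcs, hU]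
    have e : (pcs ++ (U ++ Z2)).drop (P.kk N * cP N + P.uLen N (tStar f N)) = Z2 := by
      rw [← List.append_assoc, List.drop_append_of_le_length hL2.ge, List.drop_of_length_le hL2.le, List.nil_append]
    rw [List.take_append_of_le_length hL.ge, List.take_of_length_le hL.le, List.drop_append_of_le_length hL.ge, List.drop_of_length_le hL.le,
      List.nil_append, List.append_assoc pcs U Z2, List.take_append_of_le_length hpcs.ge, List.take_of_length_le hpcs.le,
      List.drop_append_of_le_length hpcs.ge, List.drop_of_length_le hpcs.le, List.nil_append, List.take_append_of_le_length hU.ge,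
      List.take_of_length_le hU.le, e,
      hΦv _ (by rw [List.length_append, List.length_append, List.length_append,
        length_Esample hlp (τ := []) (by simp) (fun h => absurd h Bool.false_ne_true) hpcs hU hZ2, hZ1, hU1, hU3, rLen]),
      phiStr_Esample hlp ht hpcs hU hZ2 hZ1 hU1]
    rfl
  rw [uniformAvg_congr fun pcs hpcs => uniformAvg_congr fun U hU => uniformAvg_congr fun Z2 hZ2 => uniformAvg_congr fun Z1 hZ1 =>
    uniformAvg_congr fun U1 hU1 => uniformAvg_congr fun U3 hU3 => hint pcs U Z2 Z1 U1 U3 hpcs hU hZ2 hZ1 hU1 hU3]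
  -- move `U₃` to the front
  have s1 : (uniformAvg (P.kk N * cP N) fun pcs => uniformAvg (P.uLen N (tStar f N)) fun U => uniformAvg (P.mlen N (tStar f N)) fun Z2 =>
      uniformAvg (P.m1 N a) fun Z1 => uniformAvg (P.key1 N a) fun U1 => uniformAvg (P.key3 N a) fun U3 => B pcs U Z2 Z1 U1 U3) =
      uniformAvg (P.key3 N a) fun U3 => uniformAvg (P.kk N * cP N) fun pcs => uniformAvg (P.uLen N (tStar f N)) fun U =>
        uniformAvg (P.mlen N (tStar f N)) fun Z2 => uniformAvg (P.m1 N a) fun Z1 => uniformAvg (P.key1 N a) fun U1 => B pcs U Z2 Z1 U1 U3 := by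
    rw [uniformAvg_congr fun pcs _ => uniformAvg_congr fun U _ => uniformAvg_congr fun Z2 _ => uniformAvg_congr fun Z1 _ =>
      uniformAvg_comm (P.key1 N a) (P.key3 N a) (fun U1 U3 => B pcs U Z2 Z1 U1 U3)]
    rw [uniformAvg_congr fun pcs _ => uniformAvg_congr fun U _ => uniformAvg_congr fun Z2 _ =>
      uniformAvg_comm (P.m1 N a) (P.key3 N a) (fun Z1 U3 => uniformAvg (P.key1 N a) fun U1 => B pcs U Z2 Z1 U1 U3)]
    rw [uniformAvg_congr fun pcs _ => uniformAvg_congr fun U _ =>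
      uniformAvg_comm (P.mlen N (tStar f N)) (P.key3 N a) (fun Z2 U3 => uniformAvg (P.m1 N a) fun Z1 => uniformAvg (P.key1 N a) fun U1 => B pcs U Z2 Z1 U1 U3)]
    rw [uniformAvg_congr fun pcs _ =>
      uniformAvg_comm (P.uLen N (tStar f N)) (P.key3 N a) (fun U U3 => uniformAvg (P.mlen N (tStar f N)) fun Z2 => uniformAvg (P.m1 N a) fun Z1 =>
        uniformAvg (P.key1 N a) fun U1 => B pcs U Z2 Z1 U1 U3)]
    exact uniformAvg_comm (P.kk N * cP N) (P.key3 N a) (fun pcs U3 => uniformAvg (P.uLen N (tStar f N)) fun U => uniformAvg (P.mlen N (tStar f N)) fun Z2 =>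
      uniformAvg (P.m1 N a) fun Z1 => uniformAvg (P.key1 N a) fun U1 => B pcs U Z2 Z1 U1 U3)
  rw [s1]
  have hblk : ∀ U3 : List Bool, (uniformAvg (P.kk N * cP N) fun pcs => uniformAvg (P.uLen N (tStar f N)) fun U =>
      uniformAvg (P.mlen N (tStar f N)) fun Z2 => uniformAvg (P.m1 N a) fun Z1 => uniformAvg (P.key1 N a) fun U1 => B pcs U Z2 Z1 U1 U3) =
      (∑ ω : Fin (P.kk N) → PC N, uniformAvg (P.uLen N (tStar f N)) fun U => uniformAvg (P.mlen N (tStar f N)) fun Z2 => uniformAvg (P.m1 N a) fun Z1 =>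
        uniformAvg (P.key1 N a) fun U1 => pD D N (lay U3 (List.ofFn fun i : Fin (P.kk N) => pcS N (ω i).toList).flatten
          (hashStr (P.fLen N) (P.m3 N a) U3 (List.ofFn fun i : Fin (P.kk N) => g f (pcW N (ω i).toList ++ pcR N (ω i).toList)).flatten) U Z2 Z1 U1)) /
        2 ^ (P.kk N * cP N) := by
    intro U3
    have h := GAvg.uniformAvg_blocks (P.kk N) (cP N) (fun bl => uniformAvg (P.uLen N (tStar f N)) fun U => uniformAvg (P.mlen N (tStar f N)) fun Z2 =>
      uniformAvg (P.m1 N a) fun Z1 => uniformAvg (P.key1 N a) fun U1 => pD D N (lay U3 (List.ofFn fun i : Fin (P.kk N) => pcS N (bl i)).flatten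
        (hashStr (P.fLen N) (P.m3 N a) U3 (List.ofFn fun i : Fin (P.kk N) => g f (pcW N (bl i) ++ pcR N (bl i))).flatten) U Z2 Z1 U1))
    dsimp only at h
    rw [← h]
    refine uniformAvg_congr fun pcs _ => ?_
    simp only [hB, ← fprimes_eq, ← yprimes_eq]
  rw [uniformAvg]
  simp only [hblk, inner3_eq hlp D ht]
  rw [Finset.sum_div]
  conv_rhs => rw [Finset.sum_div]
  refine Finset.sum_congr rfl fun U3 _ => ?_
  rw [div_div, mul_comm ((2 : ℝ) ^ (P.kk N * cP N))]
  rfl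

/-- **Step (3) of the proof of Theorem 7.0.5, quantitatively**: for every `D`,
`|Pr[D(H₂)=1] − Pr[D(H₃)=1]| ≤ 2e^{−2kη²} + ½ √(2^{m₃}·2^{1−kmin₃})`, `kmin₃ = k·eₙ − kη·cP`.
[cite: HastadImpagliazzoLevinLuby1999, Thm 7.0.5 (proof, step (3), via Cor. 4.5.3)] -/
theorem abs_prX2_sub_prX3_le (hlp : IsLengthPreserving f) (D : RandAlg (List Bool) Bool) {N a : ℕ} (ht : tOfA N a = tStar f N)
    {ΦF : List Bool → List Bool}
    (hΦv : ∀ β : List Bool, β.length = P.sLen N (tStar f N) + P.rLen N a → ΦF (boolPair (unaryEncodeNat N) (boolPair (ones a) β)) = P.phiStr N a β)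
    (hk : 0 < P.kk N) {η : ℝ} (hη : 0 ≤ η) (hε : 2 * Real.exp (-2 * P.kk N * η ^ 2) ≤ 1) :
    |(acceptPMF D N (((P.Eens f N).bind fun α => (uniformBits (P.rLen N a)).map fun R => α ++ R).map fun β =>
          ΦF (boolPair (unaryEncodeNat N) (boolPair (ones a) β))) true).toReal -
        (acceptPMF D N (uniformBits (P.outLen N a)) true).toReal| ≤
      2 * Real.exp (-2 * P.kk N * η ^ 2) + 2⁻¹ * Real.sqrt (2 ^ P.m3 N a * (2 * (2 : ℝ) ^ (-(P.kk N * entN f N - P.kk N * η * cP N)))) := by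
  classical
  have hPC : 1 < Fintype.card (PC N) := by
    rw [card_vector, Fintype.card_bool]
    have : 1 ≤ cP N := by unfold cP rlen; nlinarith
    calc 1 < 2 ^ 1 := by norm_num
      _ ≤ 2 ^ cP N := Nat.pow_le_pow_right (by norm_num) this
  have hkey : P.m3 N a * (P.kk N * Lg N + 1) ≤ P.key3 N a := by unfold key3 fLen; exact le_rfl
  have h := Extract.extract_cond_test_smooth (x := x3 f N) (y := y3 N) hk hη hPC hkey hε (P.F3 D N a)
    (fun cv p => (F3_mem D N a cv p).1) (fun cv p => (F3_mem D N a cv p).2)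
  rw [prX2_eq hlp D ht hΦv, prX3_eq]
  have hc1 : ((Finset.univ : Finset (List.Vector Bool (P.key3 N a))).card : ℝ) = 2 ^ P.key3 N a := by
    rw [Finset.card_univ, card_vector, Fintype.card_bool]; push_cast; ring
  have hc2 : ((Finset.univ : Finset (Fin (P.kk N) → PC N)).card : ℝ) = 2 ^ P.Lp N := by
    rw [Finset.card_univ, Fintype.card_fun, Fintype.card_fin, card_vector, Fintype.card_bool, Lp, ← pow_mul, mul_comm]; push_cast; ring
  have hc3 : (Fintype.card (Fin (P.m3 N a) → ZMod 2) : ℝ) = 2 ^ P.m3 N a := by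
    rw [Fintype.card_fun, Fintype.card_fin, ZMod.card]; push_cast; ring
  have hlog : Real.logb 2 (Fintype.card (PC N)) = cP N := by
    rw [card_vector, Fintype.card_bool]; push_cast; rw [Real.logb_pow, Real.logb_self_eq_one one_lt_two, mul_one]
  rw [hc1, hc2, hc3, hlog, condEnt_step3 hlp] at h
  exact h

end Params

end GH

end HILL

end Literature.Computability.Cryptography
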